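import Mathlib
import Literature.Analysis.Matrix.TraceJensenInequality
import Literature.Analysis.Matrix.BallCarlenLiebKey
import HarnessLib

/-!
# Ball–Carlen–Lieb optimal 2-uniform convexity, II: the local second-order expansion
# (Ricard–Xu's Lemma 5) for real symmetric matrices

Sources: É. Ricard, Q. Xu, *A noncommutative martingale convexity inequality*, Ann. Probab. 44 (2016)
867–882 = arXiv:1405.0431 [RicardXu2016], §2, Lemma 5 and its proof (held text `paper:arxiv-1405.0431`
pp. 4–5, read first-hand): for self-adjoint `a, b` with `a` invertible and `1 < p < 2`,
`D² ‖a + t b‖_p² |_{t=0} ≥ 2(p-1) ‖b‖_p²` ((D²_{a,b})), obtained from the second-order estimate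
`(1/p) ‖a‖_p^{2-p} ψ''(0) ≥ (p-1)‖b‖_p²`, `ψ(t) = Tr|a + tb|^p` ((df1)); K. Ball, E. Carlen, E. H. Lieb,
Invent. Math. 115 (1994) [BallCarlenLieb1994], Thm. 1 (the result this serves).

THIS FILE proves (D²_{a,b}) for real symmetric matrices as an explicit SECOND-DIFFERENCE bound with a
cubic error term (`normSq_second_difference`):
for `a` invertible, `b` symmetric, `1 < p < 2` there are `δ > 0`, `C` with
`(Tr|a+hb|^p)^{2/p} + (Tr|a-hb|^p)^{2/p} - 2 (Tr|a|^p)^{2/p} ≥ 2(p-1) h² (Tr|b|^p)^{2/p} - C|h|³`, `|h| ≤ δ`.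
The source differentiates `ψ` twice through resolvent integrals; Mathlib has no calculus for matrix
functions, so the second-order information is extracted here WITHOUT derivatives of matrix functions,
by a lower bound that is sharp to second order:

* (`PartA`) an entrywise size `ent`, second-order jets `F(h) = F₀ + hF₁ + h²F₂ + O(h³)` with a product
  rule, and the **Cayley transform** `U(h) = (1 - (h/2)K)⁻¹(1 + (h/2)K)` of the skew matrix
  `K_{ij} = b_{ij}/(λ_j - λ_i)` (first-order perturbation of the eigenbasis of `a = diag(λ)`): `U(h)` is
  exactly orthogonal and `U(h) = 1 + hK + (h²/2)K² + (h³/4)K³(1-(h/2)K)⁻¹`;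
* (`PartB`) the scalar second-order Taylor bound `|λ+v|^p ≥ |λ|^p + f_p'(λ)v + ½f_p''(λ)v² - c|λ|^{p-3}|v|³`
  (`|v| ≤ |λ|/2`, via convexity of the Taylor remainder of `(1+u)^p` and Bernoulli for the exponent
  `p - 2 ∈ [-1,0]`), the supporting line of `x^{2/p}`, and convexity of `|x|^p`;
* (`PartC`) the **pre-rotation** inside the eigenvalue classes of `a` (degenerate perturbation theory):
  an orthogonal `W` commuting with `diag(λ)` such that `Wᵀ b W` has no off-diagonal entries inside a class;
* (`Frame`, `Assembly`) **Peierls–Jensen in the rotated basis** (tree: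
  `TraceJensen.sum_peierls_jensen_le`): `Tr|a+hb|^p ≥ Σ_k |N(h)_{kk}|^p`, `N(h) = U(h)ᵀ(a+hb)U(h)`, whose
  diagonal is `λ_k + h b_{kk} + h² γ_k + O(h³)`, `γ_k = Σ_{λ_j≠λ_k} b_{kj}²/(λ_k-λ_j)`; the scalar Taylor
  bound and the identity `Σ_k f'(λ_k)γ_k + ½Σ_k f''(λ_k)b_{kk}² = ½ Σ_{ij} dd(λ_i,λ_j) b_{ij}²` give
  `Tr|a+hb|^p ≥ Tr|a|^p + h Tr(f'(a)b) + (h²/2) Σ_{ij} dd(λ_i,λ_j)b_{ij}² - C|h|³` (`frame_expansion` — the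
  second-order coefficient is the source's `ψ''(0)/2`, [RicardXu2016, (int1)]); the **key inequality**
  of `BallCarlenLiebKey.lean` (`key_inequality`, [RicardXu2016, (df1)]) and the supporting line of
  `x ↦ x^{2/p}` at `Tr|a|^p` then give (D²_{a,b}) (`diag_second_difference`,
  `trAbsPow_second_difference`, `normSq_second_difference`).

The globalisation (convexity of `t ↦ ‖X+tY‖_p² - (p-1)t²‖Y‖_p²`, singular points, the two-point
inequality) is `BallCarlenLieb.lean`. Everything here is PROVED: no named facts, no instances, no
notation. WHAT THIS IS NOT: not the two-point inequality itself; real symmetric matrices only.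
-/

noncomputable section
open Real Set Matrix Finset

namespace Literature.Analysis.Matrix.BallCarlenLieb

section PartA


variable {n : Type*} [Fintype n]

/-! ### The entrywise `ℓ¹` size of a matrix -/

/-- `ent M = Σ_{i,j} |M_{ij}|`, a submultiplicative size used for the remainder estimates. [folklore] -/
def ent (M : Matrix n n ℝ) : ℝ := ∑ i, ∑ j, |M i j|

/-- `ent M ≥ 0`. [folklore] -/
private theorem ent_nonneg (M : Matrix n n ℝ) : 0 ≤ ent M :=
  sum_nonneg fun _ _ => sum_nonneg fun _ _ => abs_nonneg _

/-- Every entry is bounded by `ent`: `|M_{ij}| ≤ ent M`. [folklore] -/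
private theorem abs_apply_le_ent (M : Matrix n n ℝ) (i j : n) : |M i j| ≤ ent M := by
  unfold ent
  calc |M i j| ≤ ∑ j', |M i j'| :=
        single_le_sum (f := fun j' => |M i j'|) (fun _ _ => abs_nonneg _) (mem_univ j)
    _ ≤ ∑ i', ∑ j', |M i' j'| :=
        single_le_sum (f := fun i' => ∑ j', |M i' j'|) (fun _ _ => sum_nonneg fun _ _ => abs_nonneg _)
          (mem_univ i)

/-- `ent` is subadditive. [folklore] -/
private theorem ent_add_le (A B : Matrix n n ℝ) : ent (A + B) ≤ ent A + ent B := by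
  unfold ent
  rw [← sum_add_distrib]
  refine sum_le_sum fun i _ => ?_
  rw [← sum_add_distrib]
  exact sum_le_sum fun j _ => abs_add_le _ _

/-- `ent (-A) = ent A`. [folklore] -/
private theorem ent_neg (A : Matrix n n ℝ) : ent (-A) = ent A := by
  simp [ent, abs_neg]

/-- `ent (A - B) ≤ ent A + ent B`. [folklore] -/
private theorem ent_sub_le (A B : Matrix n n ℝ) : ent (A - B) ≤ ent A + ent B := by
  rw [sub_eq_add_neg]
  exact (ent_add_le A (-B)).trans (by rw [ent_neg])

/-- `ent (c • A) = |c| ent A`. [folklore] -/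
private theorem ent_smul (c : ℝ) (A : Matrix n n ℝ) : ent (c • A) = |c| * ent A := by
  simp [ent, abs_mul, mul_sum]

/-- `ent 0 = 0`. [folklore] -/
private theorem ent_zero : ent (0 : Matrix n n ℝ) = 0 := by simp [ent]

/-- `ent` is submultiplicative: `ent (AB) ≤ ent A · ent B`. [folklore] -/
private theorem ent_mul_le (A B : Matrix n n ℝ) : ent (A * B) ≤ ent A * ent B := by
  unfold ent
  calc ∑ i, ∑ j, |(A * B) i j| ≤ ∑ i, ∑ j, ∑ k, |A i k| * |B k j| := by
        refine sum_le_sum fun i _ => sum_le_sum fun j _ => ?_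
        rw [Matrix.mul_apply]
        exact (abs_sum_le_sum_abs _ _).trans (le_of_eq (sum_congr rfl fun k _ => abs_mul _ _))
    _ = ∑ i, ∑ k, |A i k| * ∑ j, |B k j| := by
        refine sum_congr rfl fun i _ => ?_
        rw [sum_comm]
        exact sum_congr rfl fun k _ => by rw [mul_sum]
    _ ≤ ∑ i, ∑ k, |A i k| * ∑ k', ∑ j, |B k' j| := by
        refine sum_le_sum fun i _ => sum_le_sum fun k _ => ?_
        refine mul_le_mul_of_nonneg_left ?_ (abs_nonneg _)
        exact single_le_sum (f := fun k' => ∑ j, |B k' j|) (fun _ _ => sum_nonneg fun _ _ => abs_nonneg _)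
          (mem_univ k)
    _ = (∑ i, ∑ k, |A i k|) * ∑ k', ∑ j, |B k' j| := by rw [sum_mul]; exact sum_congr rfl fun i _ => by rw [sum_mul]

omit [Fintype n] in
/-- `ent Aᵀ = ent A`. [folklore] -/
private theorem ent_transpose [Fintype n] (A : Matrix n n ℝ) : ent Aᵀ = ent A := by
  unfold ent
  rw [sum_comm]
  rfl

/-- `ent 1 = |n|`. [folklore] -/
private theorem ent_one [DecidableEq n] : ent (1 : Matrix n n ℝ) = Fintype.card n := by
  unfold ent
  simp [Matrix.one_apply, apply_ite, Finset.sum_ite_eq]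

/-! ### Second-order jets `F(h) = F₀ + h F₁ + h² F₂ + O(h³)` -/

/-- The quadratic Taylor polynomial with matrix coefficients. [folklore] -/
def jet (F0 F1 F2 : Matrix n n ℝ) (h : ℝ) : Matrix n n ℝ := F0 + h • F1 + h ^ 2 • F2

/-- `F(h) = F₀ + h F₁ + h² F₂ + O(|h|³)` near `h = 0`, with an explicit radius and constant. [folklore] -/
private def IsJet (F : ℝ → Matrix n n ℝ) (F0 F1 F2 : Matrix n n ℝ) : Prop :=
  ∃ δ : ℝ, 0 < δ ∧ ∃ C : ℝ, 0 ≤ C ∧ ∀ h : ℝ, |h| ≤ δ → ent (F h - jet F0 F1 F2 h) ≤ C * |h| ^ 3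

/-- `a + h b` is a jet `(a, b, 0)`. [folklore] -/
private theorem isJet_affine (a b : Matrix n n ℝ) : IsJet (fun h => a + h • b) a b 0 := by
  refine ⟨1, one_pos, 0, le_rfl, fun h _ => ?_⟩
  simp [jet, ent_zero]

/-- Transposes of jets are jets. [folklore] -/
private theorem isJet_transpose {F : ℝ → Matrix n n ℝ} {F0 F1 F2 : Matrix n n ℝ} (hF : IsJet F F0 F1 F2) :
    IsJet (fun h => (F h)ᵀ) F0ᵀ F1ᵀ F2ᵀ := by
  obtain ⟨δ, hδ, C, hC, hF⟩ := hF
  refine ⟨δ, hδ, C, hC, fun h hh => ?_⟩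
  have : (F h)ᵀ - jet F0ᵀ F1ᵀ F2ᵀ h = (F h - jet F0 F1 F2 h)ᵀ := by
    simp [jet, transpose_add, transpose_sub, transpose_smul]
  rw [this, ent_transpose]
  exact hF h hh

/-- Rewriting the coefficients of a jet. [folklore] -/
private theorem isJet_congr {F : ℝ → Matrix n n ℝ} {F0 F1 F2 G0 G1 G2 : Matrix n n ℝ} (hF : IsJet F F0 F1 F2)
    (h0 : F0 = G0) (h1 : F1 = G1) (h2 : F2 = G2) : IsJet F G0 G1 G2 := by
  subst h0 h1 h2; exact hF

/-- `ent (F₀ + hF₁ + h²F₂) ≤ ent F₀ + ent F₁ + ent F₂` for `|h| ≤ 1`. [folklore] -/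
private theorem ent_jet_le (F0 F1 F2 : Matrix n n ℝ) {h : ℝ} (hh : |h| ≤ 1) :
    ent (jet F0 F1 F2 h) ≤ ent F0 + ent F1 + ent F2 := by
  unfold jet
  have h2 : |h| ^ 2 ≤ 1 := by
    calc |h| ^ 2 ≤ 1 ^ 2 := by gcongr
      _ = 1 := one_pow 2
  have e1 : ent (F0 + h • F1 + h ^ 2 • F2) ≤ ent (F0 + h • F1) + ent (h ^ 2 • F2) := ent_add_le _ _
  have e2 : ent (F0 + h • F1) ≤ ent F0 + ent (h • F1) := ent_add_le _ _
  rw [ent_smul] at e2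
  rw [ent_smul, abs_pow] at e1
  have f1 : |h| * ent F1 ≤ ent F1 := by
    calc |h| * ent F1 ≤ 1 * ent F1 := mul_le_mul_of_nonneg_right hh (ent_nonneg _)
      _ = ent F1 := one_mul _
  have f2 : |h| ^ 2 * ent F2 ≤ ent F2 := by
    calc |h| ^ 2 * ent F2 ≤ 1 * ent F2 := mul_le_mul_of_nonneg_right h2 (ent_nonneg _)
      _ = ent F2 := one_mul _
  linarith

/-- Product rule for jets. [folklore] -/
private theorem isJet_mul {F G : ℝ → Matrix n n ℝ} {F0 F1 F2 G0 G1 G2 : Matrix n n ℝ}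
    (hF : IsJet F F0 F1 F2) (hG : IsJet G G0 G1 G2) :
    IsJet (fun h => F h * G h) (F0 * G0) (F0 * G1 + F1 * G0) (F0 * G2 + F1 * G1 + F2 * G0) := by
  obtain ⟨δF, hδF, CF, hCF, hF⟩ := hF
  obtain ⟨δG, hδG, CG, hCG, hG⟩ := hG
  set SF := ent F0 + ent F1 + ent F2 with hSF
  set SG := ent G0 + ent G1 + ent G2 with hSG
  have hSF0 : 0 ≤ SF := by positivity [ent_nonneg F0, ent_nonneg F1, ent_nonneg F2]
  have hSG0 : 0 ≤ SG := by positivity [ent_nonneg G0, ent_nonneg G1, ent_nonneg G2]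
  refine ⟨min (min δF δG) 1, by positivity, ent (F1 * G2 + F2 * G1) + ent (F2 * G2) + SF * CG + CF * SG
    + CF * CG, by positivity [ent_nonneg (F1 * G2 + F2 * G1), ent_nonneg (F2 * G2)], fun h hh => ?_⟩
  have hhF : |h| ≤ δF := hh.trans ((min_le_left _ _).trans (min_le_left _ _))
  have hhG : |h| ≤ δG := hh.trans ((min_le_left _ _).trans (min_le_right _ _))
  have hh1 : |h| ≤ 1 := hh.trans (min_le_right _ _)
  have h3 : 0 ≤ |h| ^ 3 := by positivity
  have h31 : |h| ^ 3 ≤ 1 := by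
    calc |h| ^ 3 ≤ 1 ^ 3 := by gcongr
      _ = 1 := one_pow 3
  set RF := F h - jet F0 F1 F2 h with hRF
  set RG := G h - jet G0 G1 G2 h with hRG
  have eF : F h = jet F0 F1 F2 h + RF := by rw [hRF]; abel
  have eG : G h = jet G0 G1 G2 h + RG := by rw [hRG]; abel
  have key : F h * G h - jet (F0 * G0) (F0 * G1 + F1 * G0) (F0 * G2 + F1 * G1 + F2 * G0) h =
      (h ^ 3 • (F1 * G2 + F2 * G1) + h ^ 4 • (F2 * G2)) + jet F0 F1 F2 h * RG + RF * jet G0 G1 G2 h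
        + RF * RG := by
    rw [eF, eG]
    simp only [jet, Matrix.add_mul, Matrix.mul_add, Matrix.smul_mul, Matrix.mul_smul, smul_add]
    module
  rw [key]
  have b1 : ent (h ^ 3 • (F1 * G2 + F2 * G1) + h ^ 4 • (F2 * G2)) ≤
      (ent (F1 * G2 + F2 * G1) + ent (F2 * G2)) * |h| ^ 3 := by
    calc ent (h ^ 3 • (F1 * G2 + F2 * G1) + h ^ 4 • (F2 * G2))
        ≤ ent (h ^ 3 • (F1 * G2 + F2 * G1)) + ent (h ^ 4 • (F2 * G2)) := ent_add_le _ _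
      _ = |h| ^ 3 * ent (F1 * G2 + F2 * G1) + |h| ^ 3 * |h| * ent (F2 * G2) := by
          rw [ent_smul, ent_smul, abs_pow, abs_pow]; ring
      _ ≤ |h| ^ 3 * ent (F1 * G2 + F2 * G1) + |h| ^ 3 * 1 * ent (F2 * G2) := by
          gcongr; exact ent_nonneg _
      _ = (ent (F1 * G2 + F2 * G1) + ent (F2 * G2)) * |h| ^ 3 := by ring
  have b2 : ent (jet F0 F1 F2 h * RG) ≤ SF * CG * |h| ^ 3 := by
    calc ent (jet F0 F1 F2 h * RG) ≤ ent (jet F0 F1 F2 h) * ent RG := ent_mul_le _ _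
      _ ≤ SF * (CG * |h| ^ 3) :=
          mul_le_mul (ent_jet_le _ _ _ hh1) (hG h hhG) (ent_nonneg _) hSF0
      _ = SF * CG * |h| ^ 3 := by ring
  have b3 : ent (RF * jet G0 G1 G2 h) ≤ CF * SG * |h| ^ 3 := by
    calc ent (RF * jet G0 G1 G2 h) ≤ ent RF * ent (jet G0 G1 G2 h) := ent_mul_le _ _
      _ ≤ (CF * |h| ^ 3) * SG :=
          mul_le_mul (hF h hhF) (ent_jet_le _ _ _ hh1) (ent_nonneg _) (by positivity)
      _ = CF * SG * |h| ^ 3 := by ring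
  have b4 : ent (RF * RG) ≤ CF * CG * |h| ^ 3 := by
    calc ent (RF * RG) ≤ ent RF * ent RG := ent_mul_le _ _
      _ ≤ (CF * |h| ^ 3) * (CG * |h| ^ 3) := mul_le_mul (hF h hhF) (hG h hhG) (ent_nonneg _) (by positivity)
      _ = CF * CG * |h| ^ 3 * |h| ^ 3 := by ring
      _ ≤ CF * CG * |h| ^ 3 * 1 := by gcongr
      _ = CF * CG * |h| ^ 3 := by ring
  calc ent (h ^ 3 • (F1 * G2 + F2 * G1) + h ^ 4 • (F2 * G2) + jet F0 F1 F2 h * RG + RF * jet G0 G1 G2 h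
          + RF * RG)
      ≤ ent (h ^ 3 • (F1 * G2 + F2 * G1) + h ^ 4 • (F2 * G2)) + ent (jet F0 F1 F2 h * RG)
          + ent (RF * jet G0 G1 G2 h) + ent (RF * RG) := by
        have a1 := ent_add_le (h ^ 3 • (F1 * G2 + F2 * G1) + h ^ 4 • (F2 * G2) + jet F0 F1 F2 h * RG
          + RF * jet G0 G1 G2 h) (RF * RG)
        have a2 := ent_add_le (h ^ 3 • (F1 * G2 + F2 * G1) + h ^ 4 • (F2 * G2) + jet F0 F1 F2 h * RG)
          (RF * jet G0 G1 G2 h)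
        have a3 := ent_add_le (h ^ 3 • (F1 * G2 + F2 * G1) + h ^ 4 • (F2 * G2)) (jet F0 F1 F2 h * RG)
        linarith
    _ ≤ (ent (F1 * G2 + F2 * G1) + ent (F2 * G2)) * |h| ^ 3 + SF * CG * |h| ^ 3 + CF * SG * |h| ^ 3
          + CF * CG * |h| ^ 3 := by gcongr
    _ = _ := by ring

/-! ### The Cayley transform of a skew-symmetric matrix -/

section Cayley

variable [DecidableEq n]

omit [DecidableEq n] in
/-- `vᵀ K v = 0` for skew-symmetric `K`. [folklore] -/
private theorem dotProduct_mulVec_skew {K : Matrix n n ℝ} (hK : Kᵀ = -K) (v : n → ℝ) : v ⬝ᵥ (K *ᵥ v) = 0 := by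
  have h1 : v ⬝ᵥ (K *ᵥ v) = (Kᵀ *ᵥ v) ⬝ᵥ v := by
    rw [Matrix.dotProduct_mulVec, Matrix.mulVec_transpose]
  have h2 : (Kᵀ *ᵥ v) ⬝ᵥ v = -(v ⬝ᵥ (K *ᵥ v)) := by
    rw [hK, Matrix.neg_mulVec, neg_dotProduct, dotProduct_comm]
  linarith

/-- `1 - cK` is invertible for skew `K`: a kernel vector `v` would satisfy `|v|² = c vᵀKv = 0`. [folklore] -/
private theorem det_one_sub_smul_ne_zero {K : Matrix n n ℝ} (hK : Kᵀ = -K) (c : ℝ) : (1 - c • K).det ≠ 0 := by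
  intro hdet
  obtain ⟨v, hv0, hv⟩ := Matrix.exists_mulVec_eq_zero_iff.2 hdet
  have h1 : v = c • (K *ᵥ v) := by
    have : (1 - c • K) *ᵥ v = v - c • (K *ᵥ v) := by
      rw [Matrix.sub_mulVec, Matrix.one_mulVec, Matrix.smul_mulVec]
    rw [this] at hv
    exact sub_eq_zero.1 hv
  have h2 : v ⬝ᵥ v = 0 := by
    conv_lhs => rhs; rw [h1]
    rw [dotProduct_smul, dotProduct_mulVec_skew hK, smul_zero]
  exact hv0 (dotProduct_self_eq_zero.1 h2)

/-- `det (1 - cK)` is a unit. [folklore] -/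
private theorem isUnit_det_one_sub_smul {K : Matrix n n ℝ} (hK : Kᵀ = -K) (c : ℝ) : IsUnit (1 - c • K).det :=
  isUnit_iff_ne_zero.2 (det_one_sub_smul_ne_zero hK c)

/-- `(1 - cK)(1 - cK)⁻¹ = 1`. [folklore] -/
private theorem one_sub_smul_mul_inv {K : Matrix n n ℝ} (hK : Kᵀ = -K) (c : ℝ) :
    (1 - c • K) * (1 - c • K)⁻¹ = 1 :=
  Matrix.mul_nonsing_inv _ (isUnit_det_one_sub_smul hK c)

/-- `(1 - cK)⁻¹(1 - cK) = 1`. [folklore] -/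
private theorem inv_mul_one_sub_smul {K : Matrix n n ℝ} (hK : Kᵀ = -K) (c : ℝ) :
    (1 - c • K)⁻¹ * (1 - c • K) = 1 :=
  Matrix.nonsing_inv_mul _ (isUnit_det_one_sub_smul hK c)

omit [Fintype n] in
/-- `(1 - cK)ᵀ = 1 + cK`. [folklore] -/
private theorem transpose_one_sub_smul {K : Matrix n n ℝ} (hK : Kᵀ = -K) (c : ℝ) :
    (1 - c • K)ᵀ = 1 - (-c) • K := by
  rw [transpose_sub, transpose_one, transpose_smul, hK, smul_neg, neg_smul]

/-- `((1 - cK)⁻¹)ᵀ = (1 + cK)⁻¹`. [folklore] -/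
private theorem transpose_inv_one_sub_smul {K : Matrix n n ℝ} (hK : Kᵀ = -K) (c : ℝ) :
    ((1 - c • K)⁻¹)ᵀ = (1 - (-c) • K)⁻¹ := by
  rw [Matrix.transpose_nonsing_inv, transpose_one_sub_smul hK]

/-- The resolvent identity `R = 1 + c K R` for `R = (1 - cK)⁻¹`. [folklore] -/
private theorem inv_one_sub_smul_eq {K : Matrix n n ℝ} (hK : Kᵀ = -K) (c : ℝ) :
    (1 - c • K)⁻¹ = 1 + c • (K * (1 - c • K)⁻¹) := by
  set R := (1 - c • K)⁻¹ with hR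
  have h : (1 - c • K) * R = 1 := one_sub_smul_mul_inv hK c
  rw [Matrix.sub_mul, Matrix.one_mul, Matrix.smul_mul] at h
  exact sub_eq_iff_eq_add.1 h

/-- `ent R ≤ 2 |n|` for `R = (1 - cK)⁻¹` as soon as `|c| ent K ≤ 1/2`. [folklore] -/
private theorem ent_inv_one_sub_smul_le {K : Matrix n n ℝ} (hK : Kᵀ = -K) {c : ℝ} (hc : |c| * ent K ≤ 1 / 2) :
    ent ((1 - c • K)⁻¹) ≤ 2 * Fintype.card n := by
  set R := (1 - c • K)⁻¹ with hR
  have h1 : ent R ≤ ent (1 : Matrix n n ℝ) + |c| * ent K * ent R := by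
    calc ent R = ent (1 + c • (K * R)) := by rw [hR, ← inv_one_sub_smul_eq hK c]
      _ ≤ ent (1 : Matrix n n ℝ) + ent (c • (K * R)) := ent_add_le _ _
      _ ≤ ent (1 : Matrix n n ℝ) + |c| * (ent K * ent R) := by
          rw [ent_smul]
          exact add_le_add le_rfl (mul_le_mul_of_nonneg_left (ent_mul_le _ _) (abs_nonneg _))
      _ = _ := by ring
  rw [ent_one] at h1
  have h2 : |c| * ent K * ent R ≤ 1 / 2 * ent R := mul_le_mul_of_nonneg_right hc (ent_nonneg _)
  linarith

/-- The Cayley transform `U(h) = (1 - (h/2)K)⁻¹ (1 + (h/2)K) = 2 (1 - (h/2)K)⁻¹ - 1` of a skew-symmetric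
`K` (an orthogonal matrix agreeing with `exp(hK)` to second order). [folklore] -/
def cay (K : Matrix n n ℝ) (h : ℝ) : Matrix n n ℝ := (2 : ℝ) • (1 - (h / 2) • K)⁻¹ - 1

/-- `U(h)` is orthogonal for skew `K`. [folklore] -/
private theorem cay_transpose_mul_self {K : Matrix n n ℝ} (hK : Kᵀ = -K) (h : ℝ) : (cay K h)ᵀ * cay K h = 1 := by
  set c := h / 2 with hc
  set R := (1 - c • K)⁻¹ with hR
  set R' := (1 - (-c) • K)⁻¹ with hR'
  have hAR : (1 - c • K) * R = 1 := one_sub_smul_mul_inv hK c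
  have hR'A' : R' * (1 - (-c) • K) = 1 := inv_mul_one_sub_smul hK (-c)
  have e3 : (1 - c • K) + (1 - (-c) • K) = (2 : ℝ) • (1 : Matrix n n ℝ) := by module
  have h2 : (2 : ℝ) • (R' * R) = R' + R := by
    calc (2 : ℝ) • (R' * R) = R' * ((2 : ℝ) • (1 : Matrix n n ℝ)) * R := by
          rw [Matrix.mul_smul, Matrix.mul_one, Matrix.smul_mul]
      _ = R' * (1 - c • K) * R + R' * (1 - (-c) • K) * R := by rw [← e3, Matrix.mul_add, Matrix.add_mul]
      _ = R' + R := by rw [Matrix.mul_assoc, hAR, Matrix.mul_one, hR'A', Matrix.one_mul]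
  have hT : (cay K h)ᵀ = (2 : ℝ) • R' - 1 := by
    rw [cay, transpose_sub, transpose_smul, transpose_one, ← hc, transpose_inv_one_sub_smul hK c]
  rw [hT, cay, ← hc, ← hR]
  have : ((2 : ℝ) • R' - 1) * ((2 : ℝ) • R - 1) = (2 : ℝ) • ((2 : ℝ) • (R' * R)) - (2 : ℝ) • R' - (2 : ℝ) • R + 1 := by
    simp only [Matrix.sub_mul, Matrix.mul_sub, Matrix.smul_mul, Matrix.mul_smul, Matrix.one_mul, Matrix.mul_one,
      smul_smul]
    module
  rw [this, h2]
  module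

/-- `U(h) U(h)ᵀ = 1`. [folklore] -/
private theorem cay_mul_transpose_self {K : Matrix n n ℝ} (hK : Kᵀ = -K) (h : ℝ) : cay K h * (cay K h)ᵀ = 1 :=
  mul_eq_one_comm.1 (cay_transpose_mul_self hK h)

/-- `U(h)` belongs to the orthogonal (= real unitary) group. [folklore] -/
private theorem cay_mem_unitaryGroup {K : Matrix n n ℝ} (hK : Kᵀ = -K) (h : ℝ) :
    cay K h ∈ Matrix.unitaryGroup n ℝ := by
  rw [Matrix.mem_unitaryGroup_iff, star_eq_conjTranspose, conjTranspose_eq_transpose_of_trivial]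
  exact cay_mul_transpose_self hK h

/-- The exact third-order expansion of the Cayley transform:
`U(h) = 1 + hK + (h²/2)K² + (h³/4) K³ (1 - (h/2)K)⁻¹`. [folklore] -/
private theorem cay_eq {K : Matrix n n ℝ} (hK : Kᵀ = -K) (h : ℝ) :
    cay K h = 1 + h • K + (h ^ 2 / 2) • (K * K) + (h ^ 3 / 4) • (K * (K * (K * (1 - (h / 2) • K)⁻¹))) := by
  set c := h / 2 with hc
  set R := (1 - c • K)⁻¹ with hR
  have e0 : R = 1 + c • (K * R) := inv_one_sub_smul_eq hK c
  have f1 : K * R = K + c • (K * (K * R)) := by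
    conv_lhs => rw [e0]
    rw [Matrix.mul_add, Matrix.mul_one, Matrix.mul_smul]
  have f2 : K * (K * R) = K * K + c • (K * (K * (K * R))) := by
    conv_lhs => rw [f1]
    rw [Matrix.mul_add, Matrix.mul_smul]
  have e1 : R = 1 + c • K + c ^ 2 • (K * K) + c ^ 3 • (K * (K * (K * R))) := by
    calc R = 1 + c • (K * R) := e0
      _ = 1 + c • (K + c • (K * (K * R))) := by conv_lhs => rw [f1]
      _ = 1 + c • (K + c • (K * K + c • (K * (K * (K * R))))) := by conv_lhs => rw [f2]
      _ = _ := by module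
  have hh : h = 2 * c := by rw [hc]; ring
  have e2 : cay K h = (2 : ℝ) • R - 1 := by rw [cay, hR, hc]
  rw [e2]
  conv_lhs => rw [e1]
  rw [hh]
  module

/-- The Cayley transform is a second-order jet `(1, K, K²/2)`. [folklore] -/
private theorem isJet_cay {K : Matrix n n ℝ} (hK : Kᵀ = -K) : IsJet (cay K) 1 K ((1 / 2 : ℝ) • (K * K)) := by
  have hK0 : 0 ≤ ent K := ent_nonneg K
  refine ⟨1 / (ent K + 1), by positivity, (ent K) ^ 3 * (2 * Fintype.card n) / 4, by positivity,
    fun h hh => ?_⟩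
  have hc : |h / 2| * ent K ≤ 1 / 2 := by
    rw [abs_div, abs_two]
    have : |h| * ent K ≤ 1 := by
      calc |h| * ent K ≤ 1 / (ent K + 1) * ent K := mul_le_mul_of_nonneg_right hh hK0
        _ = ent K / (ent K + 1) := by ring
        _ ≤ 1 := by rw [div_le_one (by positivity)]; linarith
    linarith
  have hrem : cay K h - jet 1 K ((1 / 2 : ℝ) • (K * K)) h =
      (h ^ 3 / 4) • (K * (K * (K * (1 - (h / 2) • K)⁻¹))) := by
    rw [cay_eq hK h, jet]
    module
  rw [hrem, ent_smul]
  have hR := ent_inv_one_sub_smul_le hK hc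
  calc |h ^ 3 / 4| * ent (K * (K * (K * (1 - (h / 2) • K)⁻¹)))
      ≤ |h ^ 3 / 4| * (ent K * (ent K * (ent K * (2 * Fintype.card n)))) := by
        refine mul_le_mul_of_nonneg_left ?_ (abs_nonneg _)
        refine (ent_mul_le _ _).trans (mul_le_mul_of_nonneg_left ?_ hK0)
        refine (ent_mul_le _ _).trans (mul_le_mul_of_nonneg_left ?_ hK0)
        exact (ent_mul_le _ _).trans (mul_le_mul_of_nonneg_left hR hK0)
    _ = (ent K) ^ 3 * (2 * Fintype.card n) / 4 * |h| ^ 3 := by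
        rw [abs_div, abs_pow, abs_of_pos (by norm_num : (0:ℝ) < 4)]; ring

end Cayley


end PartA

section PartB


/-! ### Scalar inequalities for `|x|^p` -/

/-- Bernoulli's inequality for exponents `-1 ≤ r ≤ 0`: `1 + r u ≤ (1+u)^r` for `u > -1`. [folklore] -/
private theorem bernoulli_neg {r u : ℝ} (hr1 : -1 ≤ r) (hr0 : r ≤ 0) (hu : -1 < u) : 1 + r * u ≤ (1 + u) ^ r := by
  have h1u : 0 < 1 + u := by linarith
  obtain ⟨s, rfl⟩ : ∃ s, r = -s := ⟨-r, by ring⟩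
  have hs0 : 0 ≤ s := by linarith
  have hs1 : s ≤ 1 := by linarith
  have hB : (1 + u) ^ s ≤ 1 + s * u := rpow_one_add_le_one_add_mul_self hu.le hs0 hs1
  have hsu : 0 < 1 + s * u := by
    rcases le_or_gt 0 u with h | h
    · nlinarith [mul_nonneg hs0 h]
    · nlinarith [mul_le_mul_of_nonpos_right hs1 h.le]
  have hpos : 0 < (1 + u) ^ s := Real.rpow_pos_of_pos h1u s
  calc 1 + -s * u = 1 - s * u := by ring
    _ ≤ (1 + s * u)⁻¹ := by
        rw [inv_eq_one_div, le_div_iff₀ hsu]; nlinarith [sq_nonneg (s * u)]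
    _ ≤ ((1 + u) ^ s)⁻¹ := inv_anti₀ hpos hB
    _ = (1 + u) ^ (-s) := (Real.rpow_neg h1u.le s).symm

/-- A cubic with prescribed derivative. [folklore] -/
private theorem hasDerivAt_cubic (a b c d u : ℝ) :
    HasDerivAt (fun u => a + b * u + c * u ^ 2 + d * u ^ 3) (b + 2 * c * u + 3 * d * u ^ 2) u := by
  have h0 : HasDerivAt (fun _ : ℝ => a) 0 u := hasDerivAt_const u a
  have h1 : HasDerivAt (fun y : ℝ => b * y) (b * 1) u := (hasDerivAt_id' u).const_mul b
  have h2 : HasDerivAt (fun y : ℝ => c * y ^ 2) (c * (2 * u)) u := by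
    simpa using (hasDerivAt_pow 2 u).const_mul c
  have h3 : HasDerivAt (fun y : ℝ => d * y ^ 3) (d * (3 * u ^ 2)) u := by
    simpa using (hasDerivAt_pow 3 u).const_mul d
  exact (((h0.fun_add h1).fun_add h2).fun_add h3).congr_deriv (by ring)

/-- `χ(u) = (1+u)^p - (1 + pu + p(p-1)/2 u² + p(p-1)(p-2)/6 u³)` (Taylor remainder of `(1+u)^p`). [folklore] -/
def tχ (p u : ℝ) : ℝ :=
  (1 + u) ^ p - (1 + p * u + p * (p - 1) / 2 * u ^ 2 + p * (p - 1) * (p - 2) / 6 * u ^ 3)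

/-- `χ'(u)`. [folklore] -/
def tχ₁ (p u : ℝ) : ℝ := p * (1 + u) ^ (p - 1) - (p + p * (p - 1) * u + p * (p - 1) * (p - 2) / 2 * u ^ 2)

/-- `χ''(u)`. [folklore] -/
def tχ₂ (p u : ℝ) : ℝ := p * (p - 1) * (1 + u) ^ (p - 2) - (p * (p - 1) + p * (p - 1) * (p - 2) * u)

/-- `χ' = χ₁` on `(-1, ∞)`. [folklore] -/
private theorem hasDerivAt_tχ (p : ℝ) {x : ℝ} (hx : -1 < x) : HasDerivAt (tχ p) (tχ₁ p x) x := by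
  have h1 : HasDerivAt (fun y : ℝ => (1 + y) ^ p) (1 * p * (1 + x) ^ (p - 1)) x :=
    ((hasDerivAt_id x).const_add 1).rpow_const (Or.inl (by simp only [id]; linarith))
  have h2 := hasDerivAt_cubic 1 p (p * (p - 1) / 2) (p * (p - 1) * (p - 2) / 6) x
  exact (h1.fun_sub h2).congr_deriv (by simp only [tχ₁]; ring)

/-- `χ₁' = χ₂` on `(-1, ∞)`. [folklore] -/
private theorem hasDerivAt_tχ₁ (p : ℝ) {x : ℝ} (hx : -1 < x) : HasDerivAt (tχ₁ p) (tχ₂ p x) x := by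
  have h1 : HasDerivAt (fun y : ℝ => (1 + y) ^ (p - 1)) (1 * (p - 1) * (1 + x) ^ (p - 1 - 1)) x :=
    ((hasDerivAt_id x).const_add 1).rpow_const (Or.inl (by simp only [id]; linarith))
  have h2 := hasDerivAt_cubic p (p * (p - 1)) (p * (p - 1) * (p - 2) / 2) 0 x
  have h := (h1.const_mul p).fun_sub h2
  have e : (fun i : ℝ => p * (1 + i) ^ (p - 1) -
      (p + p * (p - 1) * i + p * (p - 1) * (p - 2) / 2 * i ^ 2 + 0 * i ^ 3)) = tχ₁ p := by
    funext i; simp only [tχ₁]; ring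
  rw [e] at h
  exact h.congr_deriv (by simp only [tχ₂]; rw [show p - 1 - 1 = p - 2 by ring]; ring)

/-- `χ₂ ≥ 0` on `(-1, ∞)` for `1 ≤ p ≤ 2` (Bernoulli with exponent `p - 2`). [folklore] -/
private theorem tχ₂_nonneg {p x : ℝ} (hp1 : 1 ≤ p) (hp2 : p ≤ 2) (hx : -1 < x) : 0 ≤ tχ₂ p x := by
  have hB := bernoulli_neg (r := p - 2) (by linarith) (by linarith) hx
  have hpp : 0 ≤ p * (p - 1) := by nlinarith
  simp only [tχ₂]
  nlinarith [mul_le_mul_of_nonneg_left hB hpp]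

/-- **Second-order Taylor bound for `(1+u)^p`, `1 ≤ p ≤ 2`, with the exact cubic term**:
`(1+u)^p ≥ 1 + p u + p(p-1)/2 · u² + p(p-1)(p-2)/6 · u³` for `u > -1`
(the difference `χ` is convex with a critical point at `0`, because
`(1+u)^{p-2} ≥ 1 + (p-2)u`). [folklore] -/
private theorem one_add_rpow_ge_taylor {p u : ℝ} (hp1 : 1 ≤ p) (hp2 : p ≤ 2) (hu : -1 < u) :
    1 + p * u + p * (p - 1) / 2 * u ^ 2 + p * (p - 1) * (p - 2) / 6 * u ^ 3 ≤ (1 + u) ^ p := by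
  have hχ₁0 : tχ₁ p 0 = 0 := by simp [tχ₁]
  have hχ0 : tχ p 0 = 0 := by simp [tχ]
  -- χ₁ is monotone on (-1, ∞)
  have hmono₁ : MonotoneOn (tχ₁ p) (Set.Ioi (-1)) := by
    refine monotoneOn_of_hasDerivWithinAt_nonneg (f' := tχ₂ p) (convex_Ioi _) ?_ ?_ ?_
    · exact fun x hx => (hasDerivAt_tχ₁ p hx).continuousAt.continuousWithinAt
    · intro x hx; rw [interior_Ioi] at hx ⊢; exact (hasDerivAt_tχ₁ p hx).hasDerivWithinAt
    · intro x hx; rw [interior_Ioi] at hx; exact tχ₂_nonneg hp1 hp2 hx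
  -- χ is monotone on [0, ∞) and antitone on (-1, 0]
  have hmono : MonotoneOn (tχ p) (Set.Ici 0) := by
    refine monotoneOn_of_hasDerivWithinAt_nonneg (f' := tχ₁ p) (convex_Ici _) ?_ ?_ ?_
    · intro x hx
      exact (hasDerivAt_tχ p (by simp only [Set.mem_Ici] at hx; linarith)).continuousAt.continuousWithinAt
    · intro x hx; rw [interior_Ici] at hx ⊢
      exact (hasDerivAt_tχ p (by simp only [Set.mem_Ioi] at hx; linarith)).hasDerivWithinAt
    · intro x hx; rw [interior_Ici] at hx
      have hx' : (0:ℝ) < x := hx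
      have := hmono₁ (by simp : (0:ℝ) ∈ Set.Ioi (-1)) (by simp only [Set.mem_Ioi]; linarith) hx'.le
      rw [hχ₁0] at this; exact this
  have hanti : AntitoneOn (tχ p) (Set.Ioc (-1) 0) := by
    refine antitoneOn_of_hasDerivWithinAt_nonpos (f' := tχ₁ p) (convex_Ioc _ _) ?_ ?_ ?_
    · exact fun x hx => (hasDerivAt_tχ p hx.1).continuousAt.continuousWithinAt
    · intro x hx; rw [interior_Ioc] at hx ⊢; exact (hasDerivAt_tχ p hx.1).hasDerivWithinAt
    · intro x hx; rw [interior_Ioc] at hx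
      have := hmono₁ (show x ∈ Set.Ioi (-1) from hx.1) (by simp : (0:ℝ) ∈ Set.Ioi (-1)) hx.2.le
      rw [hχ₁0] at this; exact this
  have hfinal : 0 ≤ tχ p u := by
    rcases le_or_gt 0 u with hu0 | hu0
    · have := hmono (Set.self_mem_Ici) (show u ∈ Set.Ici (0:ℝ) from hu0) hu0
      rwa [hχ0] at this
    · have := hanti ⟨hu, hu0.le⟩ ⟨by norm_num, le_rfl⟩ hu0.le
      rwa [hχ0] at this
  simp only [tχ] at hfinal
  linarith

/-- The same bound with the cubic term replaced by `-(p(p-1)(2-p)/6)|u|³`. [folklore] -/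
private theorem one_add_rpow_ge_taylor' {p u : ℝ} (hp1 : 1 ≤ p) (hp2 : p ≤ 2) (hu : -1 < u) :
    1 + p * u + p * (p - 1) / 2 * u ^ 2 - p * (p - 1) * (2 - p) / 6 * |u| ^ 3 ≤ (1 + u) ^ p := by
  have h := one_add_rpow_ge_taylor hp1 hp2 hu
  have h3 : u ^ 3 ≤ |u| ^ 3 := by
    calc u ^ 3 ≤ |u ^ 3| := le_abs_self _
      _ = |u| ^ 3 := abs_pow u 3
  have hpp : 0 ≤ p * (p - 1) := by nlinarith
  have hx : 0 ≤ p * (p - 1) * (2 - p) * (|u| ^ 3 - u ^ 3) :=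
    mul_nonneg (mul_nonneg hpp (by linarith)) (sub_nonneg.2 h3)
  nlinarith

/-- **Second-order expansion of `|λ + v|^p` at `λ ≠ 0` with a cubic remainder** (`1 ≤ p ≤ 2`,
`|v| ≤ |λ|/2`): `|λ+v|^p ≥ |λ|^p + f_p'(λ) v + ½ f_p''(λ) v² − (p(p-1)(2-p)/6)|λ|^{p-3}|v|³`,
`f_p'(λ) = pλ|λ|^{p-2}`, `f_p''(λ) = p(p-1)|λ|^{p-2}`. [folklore] -/
private theorem abs_add_rpow_ge_taylor {p lam v : ℝ} (hp1 : 1 ≤ p) (hp2 : p ≤ 2) (hlam : lam ≠ 0)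
    (hv : |v| ≤ |lam| / 2) :
    |lam| ^ p + p * lam * |lam| ^ (p - 2) * v + p * (p - 1) / 2 * |lam| ^ (p - 2) * v ^ 2
      - p * (p - 1) * (2 - p) / 6 * |lam| ^ (p - 3) * |v| ^ 3 ≤ |lam + v| ^ p := by
  set L := |lam| with hL
  have hL0 : 0 < L := abs_pos.2 hlam
  set u := v / lam with hu
  have hau : |u| = |v| / L := by rw [hu, abs_div]
  have hu1 : |u| ≤ 1 / 2 := by
    rw [hau, div_le_iff₀ hL0]; linarith
  have hum : -1 < u := by
    have := neg_abs_le u; linarith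
  have h1u : 0 < 1 + u := by linarith
  have hsplit : lam + v = lam * (1 + u) := by rw [hu]; field_simp
  have habs : |lam + v| = L * (1 + u) := by rw [hsplit, abs_mul, abs_of_pos h1u]
  have hT := one_add_rpow_ge_taylor' hp1 hp2 hum
  have hLp : 0 ≤ L ^ p := (Real.rpow_pos_of_pos hL0 p).le
  -- exponent bookkeeping: L^p = L^3 M, L^(p-2) = L M with M = L^(p-3)
  set M := L ^ (p - 3) with hM
  have eA : L ^ (p - 2) = L * M := by
    rw [hM, show p - 2 = 1 + (p - 3) by ring, Real.rpow_add hL0, Real.rpow_one]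
  have eB : L ^ p = L ^ 3 * M := by
    have : L ^ p = L ^ ((3:ℕ):ℝ) * L ^ (p - 3) := by
      rw [← Real.rpow_add hL0]; norm_num
    rw [this, Real.rpow_natCast]
  calc L ^ p + p * lam * L ^ (p - 2) * v + p * (p - 1) / 2 * L ^ (p - 2) * v ^ 2
        - p * (p - 1) * (2 - p) / 6 * M * |v| ^ 3
      = L ^ p * (1 + p * u + p * (p - 1) / 2 * u ^ 2 - p * (p - 1) * (2 - p) / 6 * |u| ^ 3) := by
        rw [eA, eB, hau, hu]
        rcases lt_or_gt_of_ne hlam with hneg | hpos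
        · have hLl : L = -lam := abs_of_neg hneg
          rw [hLl]
          field_simp
          ring
        · have hLl : L = lam := abs_of_pos hpos
          rw [hLl]
          field_simp
    _ ≤ L ^ p * (1 + u) ^ p := mul_le_mul_of_nonneg_left hT hLp
    _ = (L * (1 + u)) ^ p := (Real.mul_rpow hL0.le h1u.le).symm
    _ = |lam + v| ^ p := by rw [habs]

/-- The supporting line of the convex function `x ↦ x^q` (`q ≥ 1`) at `x₀ > 0`:
`x₀^q + q x₀^{q-1} (x - x₀) ≤ x^q` for `x ≥ 0` (Bernoulli). [folklore] -/
private theorem rpow_supporting_line {q x₀ x : ℝ} (hq : 1 ≤ q) (hx₀ : 0 < x₀) (hx : 0 ≤ x) :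
    x₀ ^ q + q * x₀ ^ (q - 1) * (x - x₀) ≤ x ^ q := by
  set s := x / x₀ - 1 with hs
  have hs1 : -1 ≤ s := by
    rw [hs]; have : 0 ≤ x / x₀ := div_nonneg hx hx₀.le; linarith
  have hB := one_add_mul_self_le_rpow_one_add hs1 hq
  have h1s : 1 + s = x / x₀ := by rw [hs]; ring
  rw [h1s, Real.div_rpow hx hx₀.le, le_div_iff₀ (Real.rpow_pos_of_pos hx₀ q)] at hB
  have e : x₀ ^ (q - 1) = x₀ ^ q / x₀ := Real.rpow_sub_one hx₀.ne' q
  rw [e]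
  have : x₀ ^ q / x₀ * (x - x₀) = x₀ ^ q * s := by rw [hs]; field_simp
  nlinarith [this]

/-- `x ↦ |x|^p` is convex on `ℝ` for `p ≥ 1`. [folklore] -/
private theorem convexOn_abs_rpow {p : ℝ} (hp : 1 ≤ p) : ConvexOn ℝ Set.univ (fun x : ℝ => |x| ^ p) := by
  refine ⟨convex_univ, fun x _ y _ a b ha hb hab => ?_⟩
  have htri : |a • x + b • y| ≤ a • |x| + b • |y| := by
    calc |a • x + b • y| ≤ |a • x| + |b • y| := abs_add_le _ _
      _ = a • |x| + b • |y| := by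
          rw [smul_eq_mul, smul_eq_mul, smul_eq_mul, smul_eq_mul, abs_mul, abs_mul, abs_of_nonneg ha,
            abs_of_nonneg hb]
  calc |a • x + b • y| ^ p ≤ (a • |x| + b • |y|) ^ p :=
        Real.rpow_le_rpow (abs_nonneg _) htri (by linarith)
    _ ≤ a • |x| ^ p + b • |y| ^ p :=
        (convexOn_rpow hp).2 (abs_nonneg x) (abs_nonneg y) ha hb hab


end PartB

section PartC


variable {n : Type*} [Fintype n] [DecidableEq n]

omit [Fintype n] [DecidableEq n] in
/-- Over `ℝ` the conjugate transpose is the transpose. [folklore] -/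
private theorem conjTranspose_eq_transpose_real' {m : Type*} (W : Matrix m m ℝ) : Wᴴ = Wᵀ := by
  ext i j; simp [conjTranspose_apply]

/-- `Wᵀ W = 1` for `W` in the real unitary (= orthogonal) group. [folklore] -/
private theorem transpose_mul_self_of_mem_unitaryGroup {m : Type*} [Fintype m] [DecidableEq m] {W : Matrix m m ℝ}
    (hW : W ∈ Matrix.unitaryGroup m ℝ) : Wᵀ * W = 1 := by
  have h := Unitary.star_mul_self_of_mem hW
  rwa [star_eq_conjTranspose, conjTranspose_eq_transpose_real'] at h

/-! ### Pre-rotation inside the eigenvalue classes of `a = diag(λ)` -/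

/-- The block of `b` on the eigenvalue class `{k : λ_k = c}` of `a = diag(λ)`. [folklore] -/
def clsBlock (lam : n → ℝ) (b : Matrix n n ℝ) (c : ℝ) : Matrix {k // lam k = c} {k // lam k = c} ℝ :=
  b.submatrix Subtype.val Subtype.val

omit [Fintype n] [DecidableEq n] in
/-- Class blocks of a symmetric matrix are symmetric. [folklore] -/
private theorem clsBlock_isHermitian (lam : n → ℝ) {b : Matrix n n ℝ} (hb : b.IsHermitian) (c : ℝ) :
    (clsBlock lam b c).IsHermitian :=
  hb.submatrix _

/-- An orthogonal diagonalizer of the class block (Mathlib's `eigenvectorUnitary`). [folklore] -/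
def clsRot (lam : n → ℝ) {b : Matrix n n ℝ} (hb : b.IsHermitian) (c : ℝ) :
    Matrix {k // lam k = c} {k // lam k = c} ℝ :=
  ((clsBlock_isHermitian lam hb c).eigenvectorUnitary : Matrix {k // lam k = c} {k // lam k = c} ℝ)

/-- `clsRot` is orthogonal. [folklore] -/
private theorem clsRot_mem (lam : n → ℝ) {b : Matrix n n ℝ} (hb : b.IsHermitian) (c : ℝ) :
    clsRot lam hb c ∈ Matrix.unitaryGroup {k // lam k = c} ℝ :=
  (clsBlock_isHermitian lam hb c).eigenvectorUnitary.prop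

/-- `clsRotᵀ clsRot = 1`. [folklore] -/
private theorem clsRot_transpose_mul_self (lam : n → ℝ) {b : Matrix n n ℝ} (hb : b.IsHermitian) (c : ℝ) :
    (clsRot lam hb c)ᵀ * clsRot lam hb c = 1 :=
  transpose_mul_self_of_mem_unitaryGroup (clsRot_mem lam hb c)

/-- `Uᵀ B U` is diagonal: the class block of `b` is diagonalized by `clsRot`. [folklore] -/
private theorem clsRot_diagonalizes (lam : n → ℝ) {b : Matrix n n ℝ} (hb : b.IsHermitian) (c : ℝ) :
    (clsRot lam hb c)ᵀ * clsBlock lam b c * clsRot lam hb c =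
      diagonal (clsBlock_isHermitian lam hb c).eigenvalues := by
  have h := Literature.Analysis.Matrix.TraceJensen.conjTranspose_mul_mul_eigenvectorUnitary
    (clsBlock_isHermitian lam hb c)
  rw [conjTranspose_eq_transpose_real'] at h
  rw [clsRot, h]
  rfl

/-- The pre-rotation `W`: block-diagonal with respect to the classes `{λ = c}`, equal to `clsRot c` on
the class `c`; it commutes with `diag(λ)` and diagonalizes every class block of `b` (degenerate
perturbation theory: the zeroth-order eigenbasis adapted to `b`). [folklore] -/
def preRot (lam : n → ℝ) {b : Matrix n n ℝ} (hb : b.IsHermitian) : Matrix n n ℝ := fun i j =>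
  if h : lam j = lam i then clsRot lam hb (lam i) ⟨i, rfl⟩ ⟨j, h⟩ else 0

omit [Fintype n] [DecidableEq n] in
/-- Entries of `preRot` inside a class. [folklore] -/
private theorem preRot_apply_of_eq [Fintype n] [DecidableEq n] (lam : n → ℝ) {b : Matrix n n ℝ} (hb : b.IsHermitian)
    {i j : n} {c : ℝ} (hi : lam i = c) (hj : lam j = c) :
    preRot lam hb i j = clsRot lam hb c ⟨i, hi⟩ ⟨j, hj⟩ := by
  subst hi
  simp only [preRot, dif_pos hj]

omit [Fintype n] [DecidableEq n] in
/-- `preRot` vanishes across classes. [folklore] -/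
private theorem preRot_apply_of_ne [Fintype n] [DecidableEq n] (lam : n → ℝ) {b : Matrix n n ℝ} (hb : b.IsHermitian)
    {i j : n} (h : lam j ≠ lam i) : preRot lam hb i j = 0 := by
  simp only [preRot, dif_neg h]

omit [DecidableEq n] in
/-- A sum over `n` of a function supported on the class `{λ = c}` is a sum over the class. [folklore] -/
private theorem sum_eq_sum_cls (lam : n → ℝ) (c : ℝ) (G : n → ℝ) (hG : ∀ k, lam k ≠ c → G k = 0) :
    ∑ k, G k = ∑ k : {k // lam k = c}, G k := by
  rw [← Finset.sum_subtype (univ.filter fun k => lam k = c) (by simp)]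
  rw [Finset.sum_filter]
  exact Finset.sum_congr rfl fun k _ => by
    by_cases h : lam k = c
    · rw [if_pos h]
    · rw [if_neg h, hG k h]

/-- `preRot` is orthogonal. [folklore] -/
private theorem preRot_transpose_mul_self (lam : n → ℝ) {b : Matrix n n ℝ} (hb : b.IsHermitian) :
    (preRot lam hb)ᵀ * preRot lam hb = 1 := by
  ext i j
  rw [Matrix.mul_apply]
  simp only [transpose_apply]
  by_cases hij : lam j = lam i
  · -- both in the class c = lam i
    rw [sum_eq_sum_cls lam (lam i) _ (fun k hk => by
      rw [preRot_apply_of_ne lam hb (fun h => hk h.symm), zero_mul])]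
    have hU := clsRot_transpose_mul_self lam hb (lam i)
    have key : ∑ k : {k // lam k = lam i}, preRot lam hb k i * preRot lam hb k j =
        ((clsRot lam hb (lam i))ᵀ * clsRot lam hb (lam i)) ⟨i, rfl⟩ ⟨j, hij⟩ := by
      rw [Matrix.mul_apply]
      refine Finset.sum_congr rfl fun k _ => ?_
      rw [transpose_apply, preRot_apply_of_eq lam hb k.2 rfl, preRot_apply_of_eq lam hb k.2 hij]
    rw [key, hU, Matrix.one_apply, Matrix.one_apply]
    simp only [Subtype.mk.injEq]
  · have h0 : ∀ k, preRot lam hb k i * preRot lam hb k j = 0 := by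
      intro k
      by_cases hki : lam i = lam k
      · have hkj : lam j ≠ lam k := fun h => hij (h.trans hki.symm)
        rw [preRot_apply_of_ne lam hb hkj, mul_zero]
      · rw [preRot_apply_of_ne lam hb hki, zero_mul]
    rw [Finset.sum_congr rfl fun k _ => h0 k, sum_const_zero, Matrix.one_apply_ne]
    exact fun h => hij (by rw [h])

/-- `preRot` belongs to the real unitary group. [folklore] -/
private theorem preRot_mem_unitaryGroup (lam : n → ℝ) {b : Matrix n n ℝ} (hb : b.IsHermitian) :
    preRot lam hb ∈ Matrix.unitaryGroup n ℝ := by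
  rw [Matrix.mem_unitaryGroup_iff', star_eq_conjTranspose, conjTranspose_eq_transpose_real']
  exact preRot_transpose_mul_self lam hb

/-- `preRot` commutes with `diag(λ)`. [folklore] -/
private theorem diagonal_mul_preRot (lam : n → ℝ) {b : Matrix n n ℝ} (hb : b.IsHermitian) :
    diagonal lam * preRot lam hb = preRot lam hb * diagonal lam := by
  ext i j
  rw [diagonal_mul, mul_diagonal]
  by_cases h : lam j = lam i
  · rw [h, mul_comm]
  · rw [preRot_apply_of_ne lam hb h, mul_zero, zero_mul]

/-- `preRotᵀ diag(λ) preRot = diag(λ)`. [folklore] -/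
private theorem preRot_conj_diagonal (lam : n → ℝ) {b : Matrix n n ℝ} (hb : b.IsHermitian) :
    (preRot lam hb)ᵀ * diagonal lam * preRot lam hb = diagonal lam := by
  rw [Matrix.mul_assoc, diagonal_mul_preRot, ← Matrix.mul_assoc, preRot_transpose_mul_self, Matrix.one_mul]

/-- The rotated `b` has no off-diagonal entries inside a class. [folklore] -/
private theorem preRot_conj_apply_eq_zero (lam : n → ℝ) {b : Matrix n n ℝ} (hb : b.IsHermitian) {i j : n}
    (hij : i ≠ j) (hc : lam j = lam i) :
    ((preRot lam hb)ᵀ * b * preRot lam hb) i j = 0 := by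
  rw [Matrix.mul_apply]
  -- restrict l to the class of i
  rw [sum_eq_sum_cls lam (lam i) _ (fun l hl => by
    rw [preRot_apply_of_ne lam hb (fun h => hl ?_), mul_zero]
    rw [← h, hc])]
  have inner : ∀ l : {k // lam k = lam i}, ((preRot lam hb)ᵀ * b) i l =
      ∑ k : {k // lam k = lam i}, clsRot lam hb (lam i) k ⟨i, rfl⟩ * b k l := by
    intro l
    rw [Matrix.mul_apply]
    rw [sum_eq_sum_cls lam (lam i) _ (fun k hk => by
      rw [transpose_apply, preRot_apply_of_ne lam hb (fun h => hk h.symm), zero_mul])]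
    refine Finset.sum_congr rfl fun k _ => ?_
    rw [transpose_apply, preRot_apply_of_eq lam hb k.2 rfl]
  have key : ∑ l : {k // lam k = lam i}, ((preRot lam hb)ᵀ * b) i l * preRot lam hb l j =
      ((clsRot lam hb (lam i))ᵀ * clsBlock lam b (lam i) * clsRot lam hb (lam i)) ⟨i, rfl⟩ ⟨j, hc⟩ := by
    rw [Matrix.mul_apply]
    refine Finset.sum_congr rfl fun l _ => ?_
    rw [inner l, preRot_apply_of_eq lam hb l.2 hc, Matrix.mul_apply]
    congr 1
  rw [key, clsRot_diagonalizes, diagonal_apply_ne]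
  exact fun h => hij (congrArg Subtype.val h)


end PartC

/-! ### The local second-order expansion in the eigenbasis of `a` -/

section Frame

variable {n : Type*} [Fintype n] [DecidableEq n]

omit [Fintype n] [DecidableEq n] in
/-- Over `ℝ`, Hermitian means symmetric. [folklore] -/
private theorem isHermitian_iff_transpose {m : Type*} (M : Matrix m m ℝ) : M.IsHermitian ↔ Mᵀ = M := by
  unfold Matrix.IsHermitian
  rw [conjTranspose_eq_transpose_real']

omit [Fintype n] in
/-- `diag(λ) + h b` is symmetric. [folklore] -/
private theorem isHermitian_diagonal_add_smul (lam : n → ℝ) {b : Matrix n n ℝ} (hb : b.IsHermitian) (h : ℝ) :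
    (diagonal lam + h • b).IsHermitian := by
  rw [isHermitian_iff_transpose] at hb ⊢
  rw [transpose_add, transpose_smul, diagonal_transpose, hb]

/-- The skew generator `K_{ij} = b_{ij}/(λ_j - λ_i)` (`0` inside the classes `λ_i = λ_j`) of the
first-order rotation of the eigenbasis of `diag(λ)` under the perturbation `h b`. [folklore]
(Rayleigh–Schrödinger perturbation theory) -/
def kgen (lam : n → ℝ) (b : Matrix n n ℝ) : Matrix n n ℝ := fun i j =>
  if lam i = lam j then 0 else b i j / (lam j - lam i)

omit [Fintype n] [DecidableEq n] in
/-- Entries of a real symmetric matrix: `b_{ji} = b_{ij}`. [folklore] -/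
private theorem herm_symm {b : Matrix n n ℝ} (hb : b.IsHermitian) (i j : n) : b j i = b i j := by
  simpa using hb.apply i j

omit [Fintype n] [DecidableEq n] in
/-- `K` is skew-symmetric. [folklore] -/
private theorem kgen_transpose (lam : n → ℝ) {b : Matrix n n ℝ} (hb : b.IsHermitian) :
    (kgen lam b)ᵀ = -kgen lam b := by
  ext i j
  rw [transpose_apply, Matrix.neg_apply]
  simp only [kgen]
  by_cases h : lam i = lam j
  · rw [if_pos h, if_pos h.symm, neg_zero]
  · rw [if_neg h, if_neg (Ne.symm h), herm_symm hb i j]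
    have h1 : lam j - lam i ≠ 0 := sub_ne_zero.2 (Ne.symm h)
    have h2 : lam i - lam j ≠ 0 := sub_ne_zero.2 h
    field_simp
    ring

/-- The matrix `a + h b` in the rotated basis `U(h) = cay K h`: `N(h) = U(h)ᵀ (a + h b) U(h)`. [folklore] -/
def rotN (lam : n → ℝ) (b : Matrix n n ℝ) (h : ℝ) : Matrix n n ℝ :=
  (cay (kgen lam b) h)ᵀ * (diagonal lam + h • b) * cay (kgen lam b) h

/-- The first-order coefficient of `N(h)`: `aK + b - Ka`. [folklore] -/
def rotN1 (lam : n → ℝ) (b : Matrix n n ℝ) : Matrix n n ℝ :=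
  diagonal lam * kgen lam b + b - kgen lam b * diagonal lam

/-- The second-order coefficient of `N(h)`: `(aK² + K²a)/2 + bK - KaK - Kb`. [folklore] -/
def rotN2 (lam : n → ℝ) (b : Matrix n n ℝ) : Matrix n n ℝ :=
  diagonal lam * ((1 / 2 : ℝ) • (kgen lam b * kgen lam b)) + (b - kgen lam b * diagonal lam) * kgen lam b
    + (-(kgen lam b * b) + ((1 / 2 : ℝ) • (kgen lam b * kgen lam b)) * diagonal lam)

/-- `N(h) = U(h)ᵀ(a + hb)U(h)` is a jet `(a, N₁, N₂)`. [folklore] -/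
private theorem isJet_rotN (lam : n → ℝ) {b : Matrix n n ℝ} (hb : b.IsHermitian) :
    IsJet (rotN lam b) (diagonal lam) (rotN1 lam b) (rotN2 lam b) := by
  have hK : (kgen lam b)ᵀ = -kgen lam b := kgen_transpose lam hb
  have jU := isJet_cay hK
  have jUT : IsJet (fun h => (cay (kgen lam b) h)ᵀ) 1 (-kgen lam b)
      ((1 / 2 : ℝ) • (kgen lam b * kgen lam b)) := by
    refine isJet_congr (isJet_transpose jU) transpose_one hK ?_
    rw [transpose_smul, transpose_mul, hK, neg_mul_neg]
  have jM := isJet_affine (diagonal lam) b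
  have j1 := isJet_mul jUT jM
  have j2 := isJet_mul j1 jU
  refine isJet_congr j2 ?_ ?_ ?_
  · rw [Matrix.one_mul, Matrix.mul_one]
  · simp only [rotN1, Matrix.one_mul, Matrix.mul_one, neg_mul]
    abel
  · simp only [rotN2, Matrix.one_mul, Matrix.mul_one, Matrix.mul_zero, zero_add, neg_mul]
    abel

/-- The second-order coefficient of the `k`-th diagonal entry of `N(h)`:
`γ_k = Σ_{λ_j ≠ λ_k} b_{kj}²/(λ_k - λ_j)` (second-order Rayleigh–Schrödinger coefficient). [folklore] -/
def gam (lam : n → ℝ) (b : Matrix n n ℝ) (k : n) : ℝ :=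
  ∑ j, if lam k = lam j then 0 else b k j ^ 2 / (lam k - lam j)

omit [Fintype n] [DecidableEq n] in
/-- `K_{kk} = 0`. [folklore] -/
private theorem kgen_apply_self (lam : n → ℝ) (b : Matrix n n ℝ) (k : n) : kgen lam b k k = 0 := by
  simp [kgen]

/-- `(N₁)_{kk} = b_{kk}` (the first-order shift of the `k`-th eigenvalue). [folklore] -/
private theorem rotN1_apply_self (lam : n → ℝ) (b : Matrix n n ℝ) (k : n) : rotN1 lam b k k = b k k := by
  simp [rotN1, Matrix.add_apply, Matrix.sub_apply, mul_diagonal, diagonal_mul]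
  ring

/-- `(N₂)_{kk} = γ_k` (the second-order coefficient). [folklore] -/
private theorem rotN2_apply_self (lam : n → ℝ) {b : Matrix n n ℝ} (hb : b.IsHermitian) (k : n) :
    rotN2 lam b k k = gam lam b k := by
  have hK := kgen_transpose lam hb
  have hKs : ∀ i j, kgen lam b j i = -kgen lam b i j := fun i j => by
    have := congrFun (congrFun hK i) j
    simpa [transpose_apply] using this
  simp only [rotN2, Matrix.add_apply, Matrix.neg_apply, Matrix.diagonal_mul, Matrix.mul_diagonal,
    Matrix.smul_apply, smul_eq_mul]
  simp only [Matrix.mul_apply, Matrix.sub_apply]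
  simp only [Matrix.diagonal_apply, mul_ite, mul_zero, Finset.sum_ite_eq', Finset.mem_univ, if_true]
  simp only [Finset.mul_sum, Finset.sum_mul, gam]
  simp only [← Finset.sum_neg_distrib, ← Finset.sum_add_distrib]
  refine Finset.sum_congr rfl fun j _ => ?_
  rw [hKs k j, herm_symm hb k j]
  by_cases h : lam k = lam j
  · simp [kgen, h]
  · simp only [kgen, if_neg h]
    have h1 : lam j - lam k ≠ 0 := sub_ne_zero.2 (Ne.symm h)
    have h2 : lam k - lam j ≠ 0 := sub_ne_zero.2 h
    field_simp
    ring

omit [Fintype n] [DecidableEq n] in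
/-- Diagonal entries of a jet polynomial. [folklore] -/
private theorem jet_apply_self (F0 F1 F2 : Matrix n n ℝ) (h : ℝ) (k : n) :
    jet F0 F1 F2 h k k = F0 k k + h * F1 k k + h ^ 2 * F2 k k := by
  simp [jet, Matrix.add_apply, Matrix.smul_apply]

/-- The diagonal entries of `U(h)ᵀ (a + h b) U(h)`: `λ_k + h b_{kk} + h² γ_k + O(h³)`, uniformly in `k`. [folklore] -/
private theorem rotN_apply_self_expansion (lam : n → ℝ) {b : Matrix n n ℝ} (hb : b.IsHermitian) :
    ∃ δ : ℝ, 0 < δ ∧ ∃ C : ℝ, 0 ≤ C ∧ ∀ h : ℝ, |h| ≤ δ → ∀ k : n,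
      |rotN lam b h k k - (lam k + h * b k k + h ^ 2 * gam lam b k)| ≤ C * |h| ^ 3 := by
  obtain ⟨δ, hδ, C, hC, hJ⟩ := isJet_rotN lam hb
  refine ⟨δ, hδ, C, hC, fun h hh k => ?_⟩
  have e : lam k + h * b k k + h ^ 2 * gam lam b k = jet (diagonal lam) (rotN1 lam b) (rotN2 lam b) h k k := by
    rw [jet_apply_self, diagonal_apply_eq, rotN1_apply_self, rotN2_apply_self lam hb]
  rw [e, ← Matrix.sub_apply]
  exact (abs_apply_le_ent _ k k).trans (hJ h hh)

/-- The scalar second-order step: from `v = hβ + h²γ + O(h³)`, `|v| ≤ B|h| ≤ |λ|/2`, to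
`|λ + v|^p ≥ |λ|^p + h f'(λ)β + h² (f'(λ)γ + ½ f''(λ) β²) - C|h|³`. [folklore] -/
private theorem scalar_step {p lam β γ C₀ B : ℝ} (hp1 : 1 ≤ p) (hp2 : p ≤ 2) (hlam : lam ≠ 0) (hC₀ : 0 ≤ C₀)
    (hB : 0 ≤ B) :
    ∃ C : ℝ, 0 ≤ C ∧ ∀ h v : ℝ, |h| ≤ 1 → |v - (h * β + h ^ 2 * γ)| ≤ C₀ * |h| ^ 3 → |v| ≤ B * |h| →
      |v| ≤ |lam| / 2 →
      |lam| ^ p + h * (dabs p lam * β) + h ^ 2 * (dabs p lam * γ + dd p lam lam / 2 * β ^ 2) - C * |h| ^ 3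
        ≤ |lam + v| ^ p := by
  set D := dabs p lam with hD
  set E := dd p lam lam with hE
  have hE' : E = p * (p - 1) * |lam| ^ (p - 2) := by rw [hE, dd, if_pos rfl]
  have hL : 0 < |lam| := abs_pos.2 hlam
  have hpp : 0 ≤ p * (p - 1) := by nlinarith
  have hE0 : 0 ≤ E := by rw [hE']; positivity
  have hE2 : 0 ≤ E / 2 := by positivity
  have h2p : 0 ≤ 2 - p := by linarith
  set c := p * (p - 1) * (2 - p) / 6 with hc
  have hc0 : 0 ≤ c := by rw [hc]; positivity
  set M := |lam| ^ (p - 3) with hM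
  have hM0 : 0 ≤ M := by positivity
  refine ⟨|D| * C₀ + E / 2 * ((|γ| + C₀) * (B + |β|)) + c * M * B ^ 3, by positivity, ?_⟩
  intro h v hh hR hvB hvl
  have hT := abs_add_rpow_ge_taylor hp1 hp2 hlam hvl
  have hT' : |lam| ^ p + D * v + E / 2 * v ^ 2 - c * M * |v| ^ 3 ≤ |lam + v| ^ p := by
    calc |lam| ^ p + D * v + E / 2 * v ^ 2 - c * M * |v| ^ 3
        = |lam| ^ p + p * lam * |lam| ^ (p - 2) * v + p * (p - 1) / 2 * |lam| ^ (p - 2) * v ^ 2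
          - p * (p - 1) * (2 - p) / 6 * |lam| ^ (p - 3) * |v| ^ 3 := by
          rw [hD, hE', hc, hM, dabs]; ring
      _ ≤ |lam + v| ^ p := hT
  -- name the remainder
  set R := v - (h * β + h ^ 2 * γ) with hRdef
  have hv : v = h * β + h ^ 2 * γ + R := by rw [hRdef]; ring
  have hh2 : |h| ^ 3 ≤ |h| ^ 2 := by
    calc |h| ^ 3 = |h| ^ 2 * |h| := by ring
      _ ≤ |h| ^ 2 * 1 := by gcongr
      _ = |h| ^ 2 := mul_one _
  -- (i) the linear term
  have i1 : -(|D| * C₀ * |h| ^ 3) ≤ D * R := by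
    have h1 : |D * R| ≤ |D| * (C₀ * |h| ^ 3) := by rw [abs_mul]; gcongr
    have h2 := neg_abs_le (D * R)
    have h3 : |D| * (C₀ * |h| ^ 3) = |D| * C₀ * |h| ^ 3 := by ring
    linarith
  -- (ii) the quadratic term
  have i2a : |v - h * β| ≤ |h| ^ 2 * (|γ| + C₀) := by
    have e1 : v - h * β = h ^ 2 * γ + R := by rw [hv]; ring
    rw [e1]
    have hR' : |R| ≤ C₀ * |h| ^ 2 := hR.trans (mul_le_mul_of_nonneg_left hh2 hC₀)
    calc |h ^ 2 * γ + R| ≤ |h ^ 2 * γ| + |R| := abs_add_le _ _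
      _ ≤ |h| ^ 2 * |γ| + C₀ * |h| ^ 2 := by rw [abs_mul, abs_pow]; exact add_le_add le_rfl hR'
      _ = |h| ^ 2 * (|γ| + C₀) := by ring
  have i2b : |v + h * β| ≤ |h| * (B + |β|) := by
    calc |v + h * β| ≤ |v| + |h * β| := abs_add_le _ _
      _ ≤ B * |h| + |h| * |β| := by rw [abs_mul]; exact add_le_add hvB le_rfl
      _ = |h| * (B + |β|) := by ring
  have i2 : -(|h| ^ 3 * ((|γ| + C₀) * (B + |β|))) ≤ v ^ 2 - (h * β) ^ 2 := by
    have e : v ^ 2 - (h * β) ^ 2 = (v - h * β) * (v + h * β) := by ring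
    have h1 : |v ^ 2 - (h * β) ^ 2| ≤ |h| ^ 3 * ((|γ| + C₀) * (B + |β|)) := by
      rw [e, abs_mul]
      calc |v - h * β| * |v + h * β| ≤ (|h| ^ 2 * (|γ| + C₀)) * (|h| * (B + |β|)) :=
            mul_le_mul i2a i2b (abs_nonneg _) (by positivity)
        _ = _ := by ring
    have h2 := neg_abs_le (v ^ 2 - (h * β) ^ 2)
    linarith
  have j2 : 0 ≤ E / 2 * (v ^ 2 - (h * β) ^ 2) + E / 2 * ((|γ| + C₀) * (B + |β|)) * |h| ^ 3 := by
    have h1 := mul_le_mul_of_nonneg_left i2 hE2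
    have e2 : E / 2 * -(|h| ^ 3 * ((|γ| + C₀) * (B + |β|))) = -(E / 2 * ((|γ| + C₀) * (B + |β|)) * |h| ^ 3) := by
      ring
    linarith
  -- (iii) the cubic term
  have i3 : |v| ^ 3 ≤ B ^ 3 * |h| ^ 3 := by
    calc |v| ^ 3 ≤ (B * |h|) ^ 3 := by gcongr
      _ = B ^ 3 * |h| ^ 3 := by ring
  have j3 : 0 ≤ c * M * B ^ 3 * |h| ^ 3 - c * M * |v| ^ 3 := by
    have h1 := mul_le_mul_of_nonneg_left i3 (mul_nonneg hc0 hM0)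
    have e3 : c * M * (B ^ 3 * |h| ^ 3) = c * M * B ^ 3 * |h| ^ 3 := by ring
    linarith
  have j1 : 0 ≤ D * R + |D| * C₀ * |h| ^ 3 := by linarith
  have gap : (|lam| ^ p + D * v + E / 2 * v ^ 2 - c * M * |v| ^ 3)
      - (|lam| ^ p + h * (D * β) + h ^ 2 * (D * γ + E / 2 * β ^ 2)
          - (|D| * C₀ + E / 2 * ((|γ| + C₀) * (B + |β|)) + c * M * B ^ 3) * |h| ^ 3)
      = (D * R + |D| * C₀ * |h| ^ 3)
        + (E / 2 * (v ^ 2 - (h * β) ^ 2) + E / 2 * ((|γ| + C₀) * (B + |β|)) * |h| ^ 3)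
        + (c * M * B ^ 3 * |h| ^ 3 - c * M * |v| ^ 3) := by
    rw [hRdef]; ring
  linarith

end Frame

/-! ### Assembly of the local expansion -/

section Assembly

variable {n : Type*} [Fintype n] [DecidableEq n]

omit [DecidableEq n] in
/-- The combinatorial identity behind the second-order coefficient:
`Σ_{ij} dd(λ_i,λ_j) b_{ij}² = Σ_k dd(λ_k,λ_k) b_{kk}² + 2 Σ_k f_p'(λ_k) γ_k` when `b` has no off-diagonal
entries inside the classes `λ_i = λ_j`. [folklore] -/
private theorem sum_dd_eq (lam : n → ℝ) {b : Matrix n n ℝ} (hb : b.IsHermitian)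
    (hcls : ∀ i j, i ≠ j → lam i = lam j → b i j = 0) (p : ℝ) :
    ∑ i, ∑ j, dd p (lam i) (lam j) * b i j ^ 2 =
      ∑ k, dd p (lam k) (lam k) * b k k ^ 2 + 2 * ∑ k, dabs p (lam k) * gam lam b k := by
  classical
  -- φ i j = dabs(λ_i) · [λ_i ≠ λ_j] b_ij² / (λ_i - λ_j)
  set φ : n → n → ℝ := fun i j =>
    dabs p (lam i) * (if lam i = lam j then 0 else b i j ^ 2 / (lam i - lam j)) with hφ
  have hterm : ∀ i j, dd p (lam i) (lam j) * b i j ^ 2 =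
      (if i = j then dd p (lam i) (lam i) * b i i ^ 2 else 0) + φ i j + φ j i := by
    intro i j
    by_cases hl : lam i = lam j
    · by_cases hij : i = j
      · subst hij; simp [hφ]
      · rw [if_neg hij, hcls i j hij hl]
        simp [hφ, hl]
    · have hij : i ≠ j := fun h => hl (by rw [h])
      rw [if_neg hij, zero_add]
      simp only [hφ, if_neg hl, if_neg (Ne.symm hl), dd, herm_symm hb i j]
      have h1 : lam i - lam j ≠ 0 := sub_ne_zero.2 hl
      have h2 : lam j - lam i ≠ 0 := sub_ne_zero.2 (Ne.symm hl)
      field_simp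
      ring
  have hrow : ∀ i, ∑ j, φ i j = dabs p (lam i) * gam lam b i := by
    intro i
    simp only [hφ, gam, Finset.mul_sum]
  calc ∑ i, ∑ j, dd p (lam i) (lam j) * b i j ^ 2
      = ∑ i, ∑ j, ((if i = j then dd p (lam i) (lam i) * b i i ^ 2 else 0) + φ i j + φ j i) :=
        Finset.sum_congr rfl fun i _ => Finset.sum_congr rfl fun j _ => hterm i j
    _ = ∑ i, ((dd p (lam i) (lam i) * b i i ^ 2) + ∑ j, φ i j + ∑ j, φ j i) := by
        refine Finset.sum_congr rfl fun i _ => ?_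
        rw [Finset.sum_add_distrib, Finset.sum_add_distrib, Finset.sum_ite_eq Finset.univ i]
        simp
    _ = ∑ i, dd p (lam i) (lam i) * b i i ^ 2 + ∑ i, ∑ j, φ i j + ∑ i, ∑ j, φ j i := by
        rw [Finset.sum_add_distrib, Finset.sum_add_distrib]
    _ = ∑ i, dd p (lam i) (lam i) * b i i ^ 2 + 2 * ∑ i, ∑ j, φ i j := by
        rw [Finset.sum_comm (f := fun i j => φ j i)]; ring
    _ = _ := by simp_rw [hrow]

/-- **The frame expansion.** For `a = diag(λ)` invertible and `b` real symmetric with no off-diagonal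
entries inside the eigenvalue classes of `a`, `1 ≤ p ≤ 2`:
`Tr|a + h b|^p ≥ Tr|a|^p + h Σ_k f_p'(λ_k) b_{kk} + (h²/2) Σ_{ij} dd(λ_i,λ_j) b_{ij}² − C|h|³` for small `h`
(Peierls–Jensen in the rotated basis `U(h)` plus the scalar Taylor bound).
[cite: RicardXu2016, Lemma 5 (proof: the computation of `ψ''(0)`, (int1))] -/
theorem frame_expansion (lam : n → ℝ) (hlam : ∀ i, lam i ≠ 0) {b : Matrix n n ℝ} (hb : b.IsHermitian)
    (hcls : ∀ i j, i ≠ j → lam i = lam j → b i j = 0) {p : ℝ} (hp1 : 1 ≤ p) (hp2 : p ≤ 2) :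
    ∃ δ : ℝ, 0 < δ ∧ ∃ C : ℝ, ∀ h : ℝ, |h| ≤ δ →
      ∑ k, |lam k| ^ p + h * ∑ k, dabs p (lam k) * b k k
        + h ^ 2 / 2 * ∑ i, ∑ j, dd p (lam i) (lam j) * b i j ^ 2 - C * |h| ^ 3
        ≤ trAbsPow p (diagonal lam + h • b) := by
  have hK : (kgen lam b)ᵀ = -kgen lam b := kgen_transpose lam hb
  -- Peierls–Jensen in the rotated basis
  have hP : ∀ h : ℝ, ∑ k, |rotN lam b h k k| ^ p ≤ trAbsPow p (diagonal lam + h • b) := by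
    intro h
    have := Literature.Analysis.Matrix.TraceJensen.sum_peierls_jensen_le
      (isHermitian_diagonal_add_smul lam hb h) (convexOn_abs_rpow hp1) (fun _ => Set.mem_univ _)
      (cay_mem_unitaryGroup hK h)
    simpa [rotN, conjTranspose_eq_transpose_real', trAbsPow] using this
  rcases isEmpty_or_nonempty n with hE | hne
  · refine ⟨1, one_pos, 0, fun h _ => ?_⟩
    simp only [Finset.univ_eq_empty, Finset.sum_empty, mul_zero, zero_mul, add_zero, sub_zero]
    exact trAbsPow_nonneg p (isHermitian_diagonal_add_smul lam hb h)
  obtain ⟨δ₀, hδ₀, C₀, hC₀, hexp⟩ := rotN_apply_self_expansion lam hb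
  set B := ent b + ent (rotN2 lam b) + C₀ + 1 with hBdef
  have hB0 : 0 < B := by
    have := ent_nonneg b; have := ent_nonneg (rotN2 lam b); rw [hBdef]; linarith
  obtain ⟨k₀, -, hk₀⟩ := Finset.exists_min_image Finset.univ (fun k => |lam k|) Finset.univ_nonempty
  set m := |lam k₀| with hm
  have hm0 : 0 < m := abs_pos.2 (hlam k₀)
  have hmk : ∀ k, m ≤ |lam k| := fun k => hk₀ k (Finset.mem_univ k)
  choose Cs hCs0 hCs using fun k =>
    scalar_step (β := b k k) (γ := gam lam b k) hp1 hp2 (hlam k) hC₀ hB0.le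
  refine ⟨min δ₀ (min 1 (m / (2 * B))), by positivity, ∑ k, Cs k, fun h hh => ?_⟩
  have hh0 : |h| ≤ δ₀ := hh.trans (min_le_left _ _)
  have hh1 : |h| ≤ 1 := hh.trans ((min_le_right _ _).trans (min_le_left _ _))
  have hhm : |h| ≤ m / (2 * B) := hh.trans ((min_le_right _ _).trans (min_le_right _ _))
  -- per-index estimate
  have hk : ∀ k, |lam k| ^ p + h * (dabs p (lam k) * b k k)
      + h ^ 2 * (dabs p (lam k) * gam lam b k + dd p (lam k) (lam k) / 2 * b k k ^ 2) - Cs k * |h| ^ 3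
      ≤ |rotN lam b h k k| ^ p := by
    intro k
    set v := rotN lam b h k k - lam k with hv
    have hR : |v - (h * b k k + h ^ 2 * gam lam b k)| ≤ C₀ * |h| ^ 3 := by
      have e : v - (h * b k k + h ^ 2 * gam lam b k) =
          rotN lam b h k k - (lam k + h * b k k + h ^ 2 * gam lam b k) := by rw [hv]; ring
      rw [e]; exact hexp h hh0 k
    have hvB : |v| ≤ B * |h| := by
      have e : v = (v - (h * b k k + h ^ 2 * gam lam b k)) + (h * b k k + h ^ 2 * gam lam b k) := by ring
      have hb1 : |b k k| ≤ ent b := abs_apply_le_ent b k k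
      have hg1 : |gam lam b k| ≤ ent (rotN2 lam b) := by
        rw [← rotN2_apply_self lam hb k]; exact abs_apply_le_ent _ k k
      have h3 : |h| ^ 3 ≤ |h| := by
        calc |h| ^ 3 = |h| * (|h| * |h|) := by ring
          _ ≤ |h| * (1 * 1) := by gcongr
          _ = |h| := by ring
      have h2 : |h| ^ 2 ≤ |h| := by
        calc |h| ^ 2 = |h| * |h| := by ring
          _ ≤ |h| * 1 := by gcongr
          _ = |h| := by ring
      calc |v| ≤ |v - (h * b k k + h ^ 2 * gam lam b k)| + |h * b k k + h ^ 2 * gam lam b k| := by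
            conv_lhs => rw [e]
            exact abs_add_le _ _
        _ ≤ C₀ * |h| ^ 3 + (|h| * |b k k| + |h| ^ 2 * |gam lam b k|) := by
            refine add_le_add hR ((abs_add_le _ _).trans (le_of_eq ?_))
            rw [abs_mul, abs_mul, abs_pow]
        _ ≤ C₀ * |h| + (|h| * ent b + |h| * ent (rotN2 lam b)) := by
            have t1 : C₀ * |h| ^ 3 ≤ C₀ * |h| := mul_le_mul_of_nonneg_left h3 hC₀
            have t2 : |h| * |b k k| ≤ |h| * ent b := mul_le_mul_of_nonneg_left hb1 (abs_nonneg _)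
            have t3 : |h| ^ 2 * |gam lam b k| ≤ |h| * ent (rotN2 lam b) :=
              calc |h| ^ 2 * |gam lam b k| ≤ |h| * |gam lam b k| :=
                    mul_le_mul_of_nonneg_right h2 (abs_nonneg _)
                _ ≤ |h| * ent (rotN2 lam b) := mul_le_mul_of_nonneg_left hg1 (abs_nonneg _)
            linarith
        _ ≤ B * |h| := by rw [hBdef]; nlinarith [abs_nonneg h]
    have hvl : |v| ≤ |lam k| / 2 := by
      calc |v| ≤ B * |h| := hvB
        _ ≤ B * (m / (2 * B)) := mul_le_mul_of_nonneg_left hhm hB0.le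
        _ = m / 2 := by field_simp
        _ ≤ |lam k| / 2 := by linarith [hmk k]
    have := hCs k h v hh1 hR hvB hvl
    have e : lam k + v = rotN lam b h k k := by rw [hv]; ring
    rw [e] at this
    exact this
  -- sum over k
  have hsum := Finset.sum_le_sum fun k (_ : k ∈ Finset.univ) => hk k
  have hQ : ∑ k, (dabs p (lam k) * gam lam b k + dd p (lam k) (lam k) / 2 * b k k ^ 2) =
      1 / 2 * ∑ i, ∑ j, dd p (lam i) (lam j) * b i j ^ 2 := by
    rw [sum_dd_eq lam hb hcls p, Finset.sum_add_distrib, mul_add, Finset.mul_sum, Finset.mul_sum,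
      Finset.mul_sum]
    rw [add_comm]
    congr 1
    · exact Finset.sum_congr rfl fun k _ => by ring
    · exact Finset.sum_congr rfl fun k _ => by ring
  have e1 : ∑ k, (|lam k| ^ p + h * (dabs p (lam k) * b k k)
      + h ^ 2 * (dabs p (lam k) * gam lam b k + dd p (lam k) (lam k) / 2 * b k k ^ 2) - Cs k * |h| ^ 3)
      = ∑ k, |lam k| ^ p + h * ∑ k, dabs p (lam k) * b k k
        + h ^ 2 / 2 * ∑ i, ∑ j, dd p (lam i) (lam j) * b i j ^ 2 - (∑ k, Cs k) * |h| ^ 3 := by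
    rw [Finset.sum_sub_distrib, Finset.sum_add_distrib, Finset.sum_add_distrib, ← Finset.mul_sum,
      ← Finset.mul_sum, ← Finset.sum_mul, hQ]
    ring
  rw [e1] at hsum
  exact hsum.trans (hP h)

/-- Orthogonal invariance of `Tr |·|^p` (similar matrices have the same multispectrum).
[cite: Bernstein2009, Prop. 4.4.5 xii)] -/
theorem trAbsPow_conj_orthogonal {P : Matrix n n ℝ} (hP : Pᵀ * P = 1) {X : Matrix n n ℝ}
    (hX : X.IsHermitian) (p : ℝ) : trAbsPow p (Pᵀ * X * P) = trAbsPow p X := by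
  have hPu : Pᵀ ∈ Matrix.unitaryGroup n ℝ := by
    rw [Matrix.mem_unitaryGroup_iff', star_eq_conjTranspose, conjTranspose_eq_transpose_real',
      transpose_transpose]
    exact mul_eq_one_comm.1 hP
  have := Literature.Analysis.Matrix.TraceJensen.re_trace_cfc_unitary_conj hX hPu (fun x : ℝ => |x| ^ p)
  simpa [trAbsPow, conjTranspose_eq_transpose_real', transpose_transpose] using this

omit [DecidableEq n] in
/-- `Pᵀ X P` is symmetric when `X` is. [folklore] -/
private theorem isHermitian_conj_orthogonal (P : Matrix n n ℝ) {X : Matrix n n ℝ} (hX : X.IsHermitian) :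
    (Pᵀ * X * P).IsHermitian := by
  rw [isHermitian_iff_transpose] at hX ⊢
  rw [transpose_mul, transpose_mul, transpose_transpose, hX, Matrix.mul_assoc]

/-- **The local second-difference bound in the eigenbasis of `a`** (`a = diag(λ)` invertible,
`b` real symmetric, `1 < p < 2`): for small `h`,
`Tr|a+hb|^p + Tr|a-hb|^p - 2 Tr|a|^p ≥ h² p(p-1) (Tr|a|^p)^{(p-2)/p} (Tr|b|^p)^{2/p} - C|h|³` —
the frame expansion after the pre-rotation inside the classes, then the key inequality
`Σ_{ij} dd(λ_i,λ_j) b_{ij}² ≥ p(p-1) ‖a‖_p^{p-2} ‖b‖_p²`.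
[cite: RicardXu2016, Lemma 5, (df1)] -/
theorem diag_second_difference [Nonempty n] (lam : n → ℝ) (hlam : ∀ i, lam i ≠ 0) {b : Matrix n n ℝ}
    (hb : b.IsHermitian) {p : ℝ} (hp1 : 1 < p) (hp2 : p < 2) :
    ∃ δ : ℝ, 0 < δ ∧ ∃ C : ℝ, ∀ h : ℝ, |h| ≤ δ →
      2 * ∑ k, |lam k| ^ p
        + h ^ 2 * (p * (p - 1) * (∑ k, |lam k| ^ p) ^ ((p - 2) / p) * trAbsPow p b ^ (2 / p))
        - C * |h| ^ 3
        ≤ trAbsPow p (diagonal lam + h • b) + trAbsPow p (diagonal lam - h • b) := by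
  set P := preRot lam hb with hPdef
  have hPP : Pᵀ * P = 1 := preRot_transpose_mul_self lam hb
  set b₂ := Pᵀ * b * P with hb₂def
  have hb₂ : b₂.IsHermitian := isHermitian_conj_orthogonal P hb
  have hcls : ∀ i j, i ≠ j → lam i = lam j → b₂ i j = 0 :=
    fun i j hij hl => preRot_conj_apply_eq_zero lam hb hij hl.symm
  have hconj : ∀ h : ℝ, Pᵀ * (diagonal lam + h • b) * P = diagonal lam + h • b₂ := by
    intro h
    rw [Matrix.mul_add, Matrix.add_mul, preRot_conj_diagonal lam hb, Matrix.mul_smul, Matrix.smul_mul,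
      hb₂def]
  have hS : ∀ h : ℝ, trAbsPow p (diagonal lam + h • b) = trAbsPow p (diagonal lam + h • b₂) := by
    intro h
    rw [← hconj h, trAbsPow_conj_orthogonal hPP (isHermitian_diagonal_add_smul lam hb h)]
  have hSb : trAbsPow p b₂ = trAbsPow p b := by rw [hb₂def, trAbsPow_conj_orthogonal hPP hb]
  obtain ⟨δ, hδ, C, hC⟩ := frame_expansion lam hlam hb₂ hcls hp1.le hp2.le
  have hkey := key_inequality lam hlam hb₂ hp1 hp2
  rw [hSb] at hkey
  refine ⟨δ, hδ, 2 * C, fun h hh => ?_⟩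
  have h1 := hC h hh
  have h2 := hC (-h) (by rwa [abs_neg])
  simp only [abs_neg, neg_smul, ← sub_eq_add_neg, neg_mul, neg_sq] at h2
  have hSm : trAbsPow p (diagonal lam - h • b) = trAbsPow p (diagonal lam - h • b₂) := by
    have := hS (-h)
    simp only [neg_smul, ← sub_eq_add_neg] at this
    exact this
  rw [hS h, hSm]
  have hh2 : 0 ≤ h ^ 2 := sq_nonneg h
  have hk2 := mul_le_mul_of_nonneg_left hkey hh2
  have e : h ^ 2 / 2 * ∑ i, ∑ j, dd p (lam i) (lam j) * b₂ i j ^ 2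
      + h ^ 2 / 2 * ∑ i, ∑ j, dd p (lam i) (lam j) * b₂ i j ^ 2
      = h ^ 2 * ∑ i, ∑ j, dd p (lam i) (lam j) * b₂ i j ^ 2 := by ring
  linarith

/-- An invertible symmetric matrix has nonzero eigenvalues (`det = Π λ_k`). [folklore] -/
private theorem eigenvalues_ne_zero_of_det_ne_zero {a : Matrix n n ℝ} (ha : a.IsHermitian)
    (hdet : a.det ≠ 0) (k : n) : ha.eigenvalues k ≠ 0 := by
  rw [ha.det_eq_prod_eigenvalues] at hdet
  simpa using (Finset.prod_ne_zero_iff.1 hdet) k (Finset.mem_univ k)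

/-- **The local second-difference bound** for `ψ(t) = Tr|a + t b|^p` at an invertible real symmetric
`a` (`b` real symmetric, `1 < p < 2`): for small `h`,
`ψ(h) + ψ(-h) - 2ψ(0) ≥ h² · p(p-1) ‖a‖_p^{p-2} ‖b‖_p² - C|h|³`
(`‖a‖_p^p = Tr|a|^p`), i.e. `(1/p)‖a‖_p^{2-p} ψ''(0) ≥ (p-1)‖b‖_p²` in second-difference form.
[cite: RicardXu2016, Lemma 5, (df1)] -/
theorem trAbsPow_second_difference [Nonempty n] {a b : Matrix n n ℝ} (ha : a.IsHermitian)
    (hb : b.IsHermitian) (hdet : a.det ≠ 0) {p : ℝ} (hp1 : 1 < p) (hp2 : p < 2) :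
    ∃ δ : ℝ, 0 < δ ∧ ∃ C : ℝ, ∀ h : ℝ, |h| ≤ δ →
      2 * trAbsPow p a
        + h ^ 2 * (p * (p - 1) * trAbsPow p a ^ ((p - 2) / p) * trAbsPow p b ^ (2 / p)) - C * |h| ^ 3
        ≤ trAbsPow p (a + h • b) + trAbsPow p (a - h • b) := by
  set V : Matrix n n ℝ := (ha.eigenvectorUnitary : Matrix n n ℝ) with hVdef
  have hVu : V ∈ Matrix.unitaryGroup n ℝ := ha.eigenvectorUnitary.prop
  have hVV : Vᵀ * V = 1 := transpose_mul_self_of_mem_unitaryGroup hVu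
  set lam := ha.eigenvalues with hlamdef
  have hlam : ∀ k, lam k ≠ 0 := eigenvalues_ne_zero_of_det_ne_zero ha hdet
  have hdiag : Vᵀ * a * V = diagonal lam := by
    have h := Literature.Analysis.Matrix.TraceJensen.conjTranspose_mul_mul_eigenvectorUnitary ha
    rw [conjTranspose_eq_transpose_real'] at h
    rw [hVdef, hlamdef, h]
    rfl
  set b₁ := Vᵀ * b * V with hb₁def
  have hb₁ : b₁.IsHermitian := isHermitian_conj_orthogonal V hb
  have hconj : ∀ h : ℝ, Vᵀ * (a + h • b) * V = diagonal lam + h • b₁ := by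
    intro h
    rw [Matrix.mul_add, Matrix.add_mul, hdiag, Matrix.mul_smul, Matrix.smul_mul, hb₁def]
  have hab : ∀ h : ℝ, (a + h • b).IsHermitian := by
    intro h
    rw [isHermitian_iff_transpose] at ha hb ⊢
    rw [transpose_add, transpose_smul, ha, hb]
  have hS : ∀ h : ℝ, trAbsPow p (a + h • b) = trAbsPow p (diagonal lam + h • b₁) := by
    intro h
    rw [← hconj h, trAbsPow_conj_orthogonal hVV (hab h)]
  have hSa : trAbsPow p a = ∑ k, |lam k| ^ p := trAbsPow_eq_sum p ha
  have hSb : trAbsPow p b₁ = trAbsPow p b := by rw [hb₁def, trAbsPow_conj_orthogonal hVV hb]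
  obtain ⟨δ, hδ, C, hC⟩ := diag_second_difference lam hlam hb₁ hp1 hp2
  refine ⟨δ, hδ, C, fun h hh => ?_⟩
  have h1 := hC h hh
  rw [hSb] at h1
  have hSm : trAbsPow p (a - h • b) = trAbsPow p (diagonal lam - h • b₁) := by
    have := hS (-h)
    simp only [neg_smul, ← sub_eq_add_neg] at this
    exact this
  rw [hSa, hS h, hSm]
  exact h1

/-- **Ricard–Xu's Lemma 5 in second-difference form** (`φ(t) = ‖a + tb‖_p² = (Tr|a+tb|^p)^{2/p}`,
`a` invertible real symmetric, `b` real symmetric, `1 < p < 2`): for small `h`,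
`φ(h) + φ(-h) - 2φ(0) ≥ 2(p-1) h² ‖b‖_p² - C|h|³`, i.e. `D²φ(0) ≥ 2(p-1)‖b‖_p²`.
[cite: RicardXu2016, Lemma 5 ((D²_{a,b}))] -/
theorem normSq_second_difference [Nonempty n] {a b : Matrix n n ℝ} (ha : a.IsHermitian)
    (hb : b.IsHermitian) (hdet : a.det ≠ 0) {p : ℝ} (hp1 : 1 < p) (hp2 : p < 2) :
    ∃ δ : ℝ, 0 < δ ∧ ∃ C : ℝ, ∀ h : ℝ, |h| ≤ δ →
      2 * trAbsPow p a ^ (2 / p) + h ^ 2 * (2 * (p - 1) * trAbsPow p b ^ (2 / p)) - C * |h| ^ 3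
        ≤ trAbsPow p (a + h • b) ^ (2 / p) + trAbsPow p (a - h • b) ^ (2 / p) := by
  obtain ⟨δ, hδ, C, hC⟩ := trAbsPow_second_difference ha hb hdet hp1 hp2
  have hp0 : 0 < p := by linarith
  set S₀ := trAbsPow p a with hS₀
  have hS₀pos : 0 < S₀ := by
    rw [hS₀, trAbsPow_eq_sum p ha]
    obtain ⟨k⟩ := (inferInstance : Nonempty n)
    have hk : 0 < |ha.eigenvalues k| ^ p :=
      Real.rpow_pos_of_pos (abs_pos.2 (eigenvalues_ne_zero_of_det_ne_zero ha hdet k)) p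
    exact lt_of_lt_of_le hk (Finset.single_le_sum (f := fun k => |ha.eigenvalues k| ^ p)
      (fun _ _ => Real.rpow_nonneg (abs_nonneg _) _) (Finset.mem_univ k))
  set q := 2 / p with hq
  have hq1 : 1 ≤ q := by rw [hq, le_div_iff₀ hp0]; linarith
  have hab : ∀ h : ℝ, (a + h • b).IsHermitian := by
    intro h
    rw [isHermitian_iff_transpose] at ha hb ⊢
    rw [transpose_add, transpose_smul, ha, hb]
  -- the slope of the supporting line
  set s := q * S₀ ^ (q - 1) with hs
  have hs0 : 0 < s := by rw [hs]; positivity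
  have hexp : s * (p * (p - 1) * S₀ ^ ((p - 2) / p)) = 2 * (p - 1) := by
    rw [hs, hq]
    have e : S₀ ^ (2 / p - 1) * S₀ ^ ((p - 2) / p) = 1 := by
      rw [← Real.rpow_add hS₀pos]
      have : 2 / p - 1 + (p - 2) / p = 0 := by field_simp; ring
      rw [this, Real.rpow_zero]
    calc 2 / p * S₀ ^ (2 / p - 1) * (p * (p - 1) * S₀ ^ ((p - 2) / p))
        = 2 / p * p * (p - 1) * (S₀ ^ (2 / p - 1) * S₀ ^ ((p - 2) / p)) := by ring
      _ = 2 * (p - 1) := by rw [e]; field_simp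
  refine ⟨δ, hδ, s * C, fun h hh => ?_⟩
  have h1 := hC h hh
  have lp := rpow_supporting_line hq1 hS₀pos (trAbsPow_nonneg p (hab h))
  have lm' := rpow_supporting_line hq1 hS₀pos (trAbsPow_nonneg p (hab (-h)))
  rw [neg_smul, ← sub_eq_add_neg] at lm'
  -- combine
  have key : 2 * S₀ ^ q + s * (trAbsPow p (a + h • b) + trAbsPow p (a - h • b) - 2 * S₀)
      ≤ trAbsPow p (a + h • b) ^ q + trAbsPow p (a - h • b) ^ q := by
    rw [hs]; nlinarith [lp, lm']
  have key2 : s * (h ^ 2 * (p * (p - 1) * S₀ ^ ((p - 2) / p) * trAbsPow p b ^ (2 / p)) - C * |h| ^ 3)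
      ≤ s * (trAbsPow p (a + h • b) + trAbsPow p (a - h • b) - 2 * S₀) :=
    mul_le_mul_of_nonneg_left (by linarith) hs0.le
  have e3 : s * (h ^ 2 * (p * (p - 1) * S₀ ^ ((p - 2) / p) * trAbsPow p b ^ (2 / p)) - C * |h| ^ 3)
      = h ^ 2 * (2 * (p - 1) * trAbsPow p b ^ (2 / p)) - s * C * |h| ^ 3 := by
    rw [← hexp]; ring
  linarith

end Assembly

end Literature.Analysis.Matrix.BallCarlenLieb
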